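import Literature.Computability.AlgebraicComplexity.MatMulOccurrenceObstructionsProofs
import Mathlib.LinearAlgebra.Matrix.Kronecker
import Mathlib.LinearAlgebra.Matrix.MvPolynomial
import Mathlib.Algebra.MvPolynomial.Funext
import Mathlib.LinearAlgebra.Eigenspace.Triangularizable
import HarnessLib

/-!
# Bürgisser–Ikenmeyer's occurrence obstruction `λ(κ)` against matrix multiplication does not exist (STOC 2013, Lemma 4.4 and Rem. 4.7, refuted as printed)

Topic `Literature/Computability/AlgebraicComplexity` (geometric complexity theory, tensor setting);
a proofs-and-plumbing file of the cell `pub-gct-max` (track T, seat lit-2, gen 25) for the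
typed-chain file `MatMulOccurrenceObstructions.lean`, whose NAMED fact
`burgisserIkenmeyer2013_rem_4_7` transcribes P. Bürgisser, C. Ikenmeyer, *Explicit lower bounds via
geometric complexity theory*, STOC 2013 = arXiv:1210.8368 [BurgisserIkenmeyer2013], Rem. 4.7: for odd
`m ≥ 3`, `2κ + 1 = m²`, `λ(κ) = (hook, hook, hook)`, `hook = (κ+1, 1^{2κ})`, (i) `λ(κ)` does not occur
in degree `3κ+1` for the unit tensor `⟨3κ⟩` and (ii) it DOES occur for `⟨m,m,m⟩`. Conjunct (i) is the
tree theorem `isotypicSum_bi2013Hook_kroneckerPow_unitTensor_eq_zero`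
(`MatMulOccurrenceObstructionsProofs.lean`); conjunct (ii) is exactly the printed **Lemma 4.4**
("There exists a matrix triple `A ∈ (GL_{m²})³` such that `f_{H_κ}(A MaMu_m) ≠ 0`, where
`κ := (m²−1)/2` for `m > 1` odd") by `lemma_4_4_of_burgisserIkenmeyer2013_rem_4_7`.

## What is proved here (kernel; no facts, no sorry)

* `isotypicSum_bi2013Hook_kroneckerPow_matMulTensor_eq_zero`: for every `m ≥ 3` and every `κ`
  with `2κ + 1 = m²`, the triple isotypic character sum of type `λ(κ)` KILLS `⟨m,m,m⟩^{⊗(3κ+1)}` —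
  `λ(κ)` does NOT occur in degree `3κ + 1` of the coordinate ring of the orbit closure of the
  matrix multiplication tensor. **Lemma 4.4 is false for every odd `m ≥ 3`,** and so is the
  occurrence-obstruction claim of Rem. 4.7 ("Hence `λ(κ)` is an occurence obstruction against
  `MaMu_m ∈ closure(GL_n³ E_n)`"): `λ(κ)` occurs in NEITHER coordinate ring.
* `not_burgisserIkenmeyer2013_rem_4_7 : ¬ burgisserIkenmeyer2013_rem_4_7` (the instance `m = 3`,
  `κ = 4` already fails).

The lower bound of Thm. 4.5 (`R̲(MaMu_m) ≥ 3m²/2 − 1/2`) is NOT affected as a statement — the tree's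
`burgisserIkenmeyer2013_thm_4_5_holds` was discharged from the Strassen–Lickteig bound — but its
printed GCT proof via `λ(κ)` does not stand. Honest framing of the cell: this corrects ONE printed
claim in the tensor setting (an occurrence obstruction that does not exist); multiplicity data and
certified rank bounds at small parameters; occurrence obstructions for determinant versus permanent
are ruled out in print (BIP 2019) — nothing here is a claim on VP vs VNP or P vs NP.

## Where the printed proof breaks

§6 evaluates `f_{H_κ}` at `A·MaMu_m` for a matrix triple `A(X)` with indeterminate first rows and
claims that the coefficient of the monomial `ωM = ∏_k X_a^{(k)} ∏_i (X_i^{(k)})^{|i−ī|}` is a sum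
"without cancellations" (§6.2), the decisive step being **Claim 24** (§6.4, STOC numbering Claim 6.9):
"All nonzero triple labelings `J` have the same coefficient of `ωM`". Claim 24 is false: two valid
sets (Def. 21 / Lemma 23) that differ by one switch `{(ii),(īī)} ↔ {(iī),(īi)}` carry OPPOSITE
signs — for one fixed labeling `J′` the induced permutation of the labels on each hyperedge `e^(k)`
is a 4-cycle, not "two switches" (the printed per-layer count uses a different representative `J′`
for each layer, which Claim 16 does not license) — so the coefficient of `ωM` is
`∑_{valid sets} ±(κ!)³` with alternating signs `= 0` (for `m = 3`: `13 824 − 13 824`). The cell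
folder `pub-gct-max-lit-2/refute-g25/` holds the exact `m = 3` computations (the whole first-row
polynomial of §2 below vanishes: all `42 174` monomials; the tree-level pairing vanishes at random
points in both index conventions; the same programs reproduce Prop. 4.2 / `χ'(H_κ) = 3κ+1` on unit
tensors and find `λ(κ')` occurring for `⟨3,3,3⟩` for the SMALLER hooks `κ' = 1, 2, 3`).

## The road taken here (refute-g25 README, "Evidence 2")

Throughout `N = 2κ + 1 = m²` letters, `d = 3κ + 1` positions, three standard tableaux `T₁, T₂, T₃`
of hook shape; `arm T` = positions outside the first column (`κ` of them), first column = `N`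
positions. Labelings `J : [d] → [m]³`, `J p = (k, μ, ν)`, with layer labels `lab₁ = (k,ν)`,
`lab₂ = (k,μ)`, `lab₃ = (μ,ν)` (the tree's `matMulTensor` convention).
1. (§1) `((A⊗B⊗C)·⟨m,m,m⟩)^{⊗d}` expands over labelings, and the pairing with `e_{T₁} ⊗ e_{T₂} ⊗ e_{T₃}`
   is `∑_J ⟨⊗ a_{lab₁J}, e_{T₁}⟩ ⟨⊗ b_{lab₂J}, e_{T₂}⟩ ⟨⊗ c_{lab₃J}, e_{T₃}⟩` (BI (†)).
2. (§2) If two positions share a column in all three tableaux the sum vanishes (`J ↦ J∘(pq)` gives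
   `(−1)³`; tree `sum_prod_mul_polytabloid_comp_swap`); otherwise (tree `share_column_of_design`,
   `snd_eq_zero_of_snd_ne_zero`) the arms are pairwise disjoint — the design `H_κ`.
3. (§3) **The elementary pairing of a hook polytabloid**: `⟨⊗_p x_{c p}, e_T⟩ =
   (∏_{p ∈ arm T} M_{0, c p}) · det M · colSign_T(c)`, because the first column of `T` has ALL `N`
   rows (`e_T = ∑_{σ ∈ C_T} sgn σ e_{w_T∘σ⁻¹}`, `C_T` = permutations of the first column, the
   `N × N` determinant reindexed along `colEquiv : col(T) ≃ Fin N` is `det M · det(𝟙_{·, c∘…})`).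
4. (§4) Hence the **factorisation** `∑_J … = det A det B det C · G(A₀, B₀, C₀)` with `G = armG` an
   explicit polynomial in the three FIRST ROWS (equivalently: `V_{λ(κ)} = det³ ⊗ S^κ ⊗ S^κ ⊗ S^κ`).
5. (§5) `GL_m³` stabilises `⟨m,m,m⟩` (`(g⊗k) ⊗ (g⁻ᵀ⊗h) ⊗ (h⁻ᵀ⊗k⁻ᵀ)`, BI 2011 Prop. 5.1; the three
   Kronecker determinants multiply to `1`), so **`G` is invariant**:
   `G(gᵀXk, g'ᵀYh, h'ᵀZk') = G(X,Y,Z)` (first rows read as `m × m` matrices; a nonzero row is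
   completed to an invertible matrix to transfer the invariance from the pairing to `G`).
6. (§6) Normal forms: `G(X,Y,Z) = G(XZᵀYᵀ, 1, 1)` for invertible `Y, Z`, and
   `G(M,1,1) = G(SMS⁻¹,1,1)`.
7. (§7) Schur: every complex matrix is conjugate to an upper triangular one (eigenvector from
   `Module.End.exists_eigenvalue`, completion to a basis, induction on the size).
8. (§8) **Emptiness**: for an obstruction design and `m ≥ 3`, every term of `G(T,1,1)`, `T` upper
   triangular, is zero. The three bijections "first column of `T_j` → letters" give
   `∑_{col_j} (imbalance of lab_j) = ∑_{all pairs}(j − i) = 0`; the imbalances `(ν−k) + (k−μ) + (μ−ν)`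
   cancel pointwise, so `∑_{arm₁}(ν−k) + ∑_{arm₂}(k−μ) + ∑_{arm₃}(μ−ν) = 0` with all terms `≥ 0`
   (`T` upper triangular, `Y = Z = 1`): ALL arm labels are diagonal. Then a letter `(i,i)` with `i`
   different from the first two coordinates of the label of the (unique) centre position cannot be
   placed in the first column of `T₁` without colliding, in layer 1, 2 or 3, with the position that
   carries `(i,i)` in another layer (six short cases) — and such `i` exists since `m ≥ 3`.
9. (§9) `G(X,Y,Z) = 0` for invertible `Y, Z` by 6–8; `G` is a polynomial in the entries of `Y`
   (resp. `Z`), so multiplying by the generic determinant and `MvPolynomial.funext` give `G ≡ 0`;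
   with 4 and 2 every elementary pairing vanishes, with `exists_sum_smul_polytabloid_eq` every
   pairing with highest-weight vectors vanishes, and
   `exists_pairing_ne_zero_of_isotypicSum₁₂₃_kroneckerPow_ne_zero` (after relabelling the alphabets
   `Fin m × Fin m ≃ Fin N`, `isotypicSum₁₂₃_kroneckerPow_ne_zero_relabel_iff`) turns this into the
   vanishing of the isotypic character sum.

## References

* [BurgisserIkenmeyer2013] P. Bürgisser, C. Ikenmeyer, *Explicit lower bounds via geometric
  complexity theory*, STOC 2013, 141–150 = arXiv:1210.8368: (2.1) (`MaMu_m`), §4.2 (Thm. 4.1,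
  (4.1)–(4.2)), §4.4 (`H_κ`, Lemma 4.4, Thm. 4.5, Rem. 4.7), §6 (proof of Lemma 4.4: (†), §6.2 `A(X)`,
  `ωM`, Claims 16–20, Def. 21, Prop. 22, Lemma 23, Claim 24).
* [BurgisserIkenmeyer2011] P. Bürgisser, C. Ikenmeyer, *Geometric complexity theory and tensor
  rank*, STOC 2011 = arXiv:1011.1350, Def. 3.1 and (3.1) (occurrence), Prop. 5.1 (stabiliser of the
  matrix multiplication tensor).
* [BurgisserIkenmeyerPanovaJAMS2019] P. Bürgisser, C. Ikenmeyer, G. Panova, *No occurrence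
  obstructions in geometric complexity theory*, J. AMS 32 (2019), Prop. 3.3 (highest-weight vectors
  of `⊗^d V` via polytabloids).
* [HornJohnson2013] R. A. Horn, C. R. Johnson, *Matrix Analysis*, 2nd ed., Thm. 2.3.1 (Schur
  triangularisation).

## Tree

`MatMulOccurrenceObstructionsProofs` (`sum_prod_mul_polytabloid_comp_swap`,
`snd_eq_zero_of_snd_ne_zero`, `mem_youngDiagram_bi2013Hook`, `mk_zero_mem_youngDiagram_bi2013Hook`,
`sum_prod_mul_sum_smul_polytabloid`, `lemma_4_4_of_burgisserIkenmeyer2013_rem_4_7`),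
`MatMulOccurrenceObstructions` (`bi2013Hook`, `burgisserIkenmeyer2013_rem_4_7`),
`IsotypicOccurrenceSemigroup` (`exists_pairing_ne_zero_of_isotypicSum₁₂₃_kroneckerPow_ne_zero`,
`isotypicSum₁₂₃_kroneckerPow_ne_zero_relabel_iff`), `PlethysmStability`
(`exists_sum_smul_polytabloid_eq`), `SchurWeylPlethysmHwMultiplicityProofs` (`StdFilling.polytabloid_apply`,
`colStab`, `rowWord`), `QuantumFunctionalsDegenerationProofs` (`actTensor_actTensor`),
`MatrixMultiplicationExponent` (`matMulTensor`, `triad`), `AsymptoticSpectrum` (`kroneckerPow`).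
Mathlib: `Matrix.det_apply'`, `det_permute'`, `det_submatrix_equiv_self`, `det_updateRow_sum`,
`det_kronecker`, `det_mvPolynomialX_ne_zero`, `eval_det_mvPolynomialX`, `MvPolynomial.funext`,
`Equiv.Perm.subtypeEquivSubtypePerm`, `sign_ofSubtype`, `Module.End.exists_eigenvalue`,
`Fintype.bijective_iff_injective_and_card`, `Finset.sum_eq_zero_iff_of_nonneg`.
-/


noncomputable section

open scoped BigOperators Matrix Kronecker

namespace Literature.Computability.AlgebraicComplexity

open Literature.NumberTheory.DiophantineGeometry (Word wordRep wordPerm wordPerm_apply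
  highestWeightSpace Weight StdFilling ydWeight ydWeight_youngDiagram fst_lt_of_mem_youngDiagram)

/-! ## §1 Restrictions of the matrix multiplication tensor and the expansion of the pairing -/

section Expansion

variable {m N d : ℕ}

/-- The matrix multiplication tensor `⟨m,m,m⟩` with its three alphabets `Fin m × Fin m` relabelled
along a bijection `e : Fin m × Fin m ≃ Fin N`. [cite: BurgisserIkenmeyer2013, (2.1)] -/
def matMulRelabel (m N : ℕ) (e : Fin m × Fin m ≃ Fin N) : Fin N → Fin N → Fin N → ℂ :=
  fun a b c => matMulTensor ℂ m m m (e.symm a) (e.symm b) (e.symm c)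

/-- Entries of a restriction `(A ⊗ B ⊗ C)·⟨m,m,m⟩`: with the rank-one terms of `⟨m,m,m⟩` indexed by
`x = (k, μ, ν)` (term `e_{(k,ν)} ⊗ e_{(k,μ)} ⊗ e_{(μ,ν)}`),
`((A⊗B⊗C)·⟨m,m,m⟩)_{abc} = ∑_x A_{a,(k,ν)} B_{b,(k,μ)} C_{c,(μ,ν)}`.
[cite: BurgisserIkenmeyer2013, (2.1) and §6 (6.1)] -/
theorem actTensor_matMulRelabel_apply (e : Fin m × Fin m ≃ Fin N)
    (A B C : Matrix (Fin N) (Fin N) ℂ) (a b c : Fin N) :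
    actTensor A B C (matMulRelabel m N e) a b c =
      ∑ x : Fin m × Fin m × Fin m,
        A a (e (x.1, x.2.2)) * B b (e (x.1, x.2.1)) * C c (e (x.2.1, x.2.2)) := by
  rw [actTensor_apply]
  -- reindex the three alphabet sums along `e`
  have h1 : ∀ (f : Fin N → ℂ), ∑ a', f a' = ∑ p : Fin m × Fin m, f (e p) := fun f =>
    (Equiv.sum_comp e f).symm
  have ht : ∀ p q r : Fin m × Fin m, matMulRelabel m N e (e p) (e q) (e r) =
      if p.1 = q.1 ∧ q.2 = r.1 ∧ p.2 = r.2 then (1 : ℂ) else 0 := fun p q r => by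
    simp [matMulRelabel, matMulTensor]
  simp only [h1, ht]
  -- innermost sum: only `r = (q.2, p.2)` survives, and only if `p.1 = q.1`
  have hr : ∀ p q : Fin m × Fin m,
      ∑ r : Fin m × Fin m, A a (e p) * B b (e q) * C c (e r) *
          (if p.1 = q.1 ∧ q.2 = r.1 ∧ p.2 = r.2 then (1 : ℂ) else 0) =
        if p.1 = q.1 then A a (e p) * B b (e q) * C c (e (q.2, p.2)) else 0 := by
    intro p q
    by_cases hpq : p.1 = q.1
    · rw [if_pos hpq, Finset.sum_eq_single (q.2, p.2)]
      · simp [hpq]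
      · intro r _ hr
        have : ¬ (p.1 = q.1 ∧ q.2 = r.1 ∧ p.2 = r.2) := by
          rintro ⟨-, h2, h3⟩
          exact hr (Prod.ext h2.symm h3.symm)
        rw [if_neg this, mul_zero]
      · intro h; exact absurd (Finset.mem_univ _) h
    · rw [if_neg hpq]
      refine Finset.sum_eq_zero fun r _ => ?_
      rw [if_neg (fun h => hpq h.1), mul_zero]
  simp only [hr]
  -- middle sum: `q = (p.1, μ)`
  have hq : ∀ p : Fin m × Fin m,
      ∑ q : Fin m × Fin m, (if p.1 = q.1 then A a (e p) * B b (e q) * C c (e (q.2, p.2)) else 0) =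
        ∑ μ : Fin m, A a (e p) * B b (e (p.1, μ)) * C c (e (μ, p.2)) := by
    intro p
    rw [Fintype.sum_prod_type, Finset.sum_eq_single p.1]
    · simp
    · intro q1 _ hq1
      refine Finset.sum_eq_zero fun μ _ => ?_
      rw [if_neg (Ne.symm hq1)]
    · intro h; exact absurd (Finset.mem_univ _) h
  simp only [hq]
  -- outer sum: `p = (k, ν)`; reorder to `(k, μ, ν)`
  rw [Fintype.sum_prod_type, Fintype.sum_prod_type]
  refine Finset.sum_congr rfl fun k _ => ?_
  rw [Fintype.sum_prod_type, Finset.sum_comm]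

/-- The `d`-th tensor power of a restriction of `⟨m,m,m⟩`, expanded over the labelings
`J : [d] → [m]³` of the positions by rank-one terms (BI 2013, (†) in §6:
"`f_H(A MaMu_m) = ∑_{J : V(H) → T} eval_H(AJ)`").
[cite: BurgisserIkenmeyer2013, §6 (†)] -/
theorem kroneckerPow_actTensor_matMulRelabel_apply (e : Fin m × Fin m ≃ Fin N)
    (A B C : Matrix (Fin N) (Fin N) ℂ) (u v w : Word N d) :
    kroneckerPow (actTensor A B C (matMulRelabel m N e)) d u v w =
      ∑ J : Fin d → Fin m × Fin m × Fin m,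
        ∏ p, (A (u p) (e ((J p).1, (J p).2.2)) * B (v p) (e ((J p).1, (J p).2.1)) *
          C (w p) (e ((J p).2.1, (J p).2.2))) := by
  simp only [kroneckerPow_apply, actTensor_matMulRelabel_apply]
  rw [Finset.prod_univ_sum (fun _ => (Finset.univ : Finset (Fin m × Fin m × Fin m)))
    (fun p x => A (u p) (e (x.1, x.2.2)) * B (v p) (e (x.1, x.2.1)) * C (w p) (e (x.2.1, x.2.2))),
    Fintype.piFinset_univ]

/-- Four finite sums commute: the outer index moves inside three others. [folklore] -/
private theorem sum_comm₄' {α β γ δ M : Type*} [Fintype α] [Fintype β] [Fintype γ] [Fintype δ]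
    [AddCommMonoid M] (f : α → β → γ → δ → M) :
    ∑ i, ∑ x, ∑ y, ∑ z, f i x y z = ∑ x, ∑ y, ∑ z, ∑ i, f i x y z := by
  rw [Finset.sum_comm]
  refine Finset.sum_congr rfl fun x _ => ?_
  rw [Finset.sum_comm]
  refine Finset.sum_congr rfl fun y _ => ?_
  exact Finset.sum_comm

/-- The three layer labels of a rank-one term `x = (k, μ, ν)` of `⟨m,m,m⟩` (tree convention:
`e_{(k,ν)} ⊗ e_{(k,μ)} ⊗ e_{(μ,ν)}`). [cite: BurgisserIkenmeyer2013, (6.1)] -/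
abbrev lab₁ (x : Fin m × Fin m × Fin m) : Fin m × Fin m := (x.1, x.2.2)
/-- Second layer label `(k, μ)` of the term `(k, μ, ν)`. [cite: BurgisserIkenmeyer2013, (6.1)] -/
abbrev lab₂ (x : Fin m × Fin m × Fin m) : Fin m × Fin m := (x.1, x.2.1)
/-- Third layer label `(μ, ν)` of the term `(k, μ, ν)`. [cite: BurgisserIkenmeyer2013, (6.1)] -/
abbrev lab₃ (x : Fin m × Fin m × Fin m) : Fin m × Fin m := (x.2.1, x.2.2)

/-- **The pairing with a power of a restriction of `⟨m,m,m⟩`, expanded** (BI 2013, (†)):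
`⟪((A⊗B⊗C)·⟨m,m,m⟩)^{⊗d}, ξ₁ ⊗ ξ₂ ⊗ ξ₃⟫ = ∑_J ⟨⊗_p a_{lab₁ J p}, ξ₁⟩ ⟨⊗_p b_{lab₂ J p}, ξ₂⟩ ⟨⊗_p c_{lab₃ J p}, ξ₃⟩`.
[cite: BurgisserIkenmeyer2013, §6 (†)] -/
theorem pairing_matMulRelabel_eq_sum (e : Fin m × Fin m ≃ Fin N)
    (A B C : Matrix (Fin N) (Fin N) ℂ) (ξ₁ ξ₂ ξ₃ : Word N d → ℂ) :
    ∑ u, ∑ v, ∑ w, kroneckerPow (actTensor A B C (matMulRelabel m N e)) d u v w *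
        triad ξ₁ ξ₂ ξ₃ u v w =
      ∑ J : Fin d → Fin m × Fin m × Fin m,
        (∑ u : Word N d, (∏ p, A (u p) (e (lab₁ (J p)))) * ξ₁ u) *
        (∑ v : Word N d, (∏ p, B (v p) (e (lab₂ (J p)))) * ξ₂ v) *
        (∑ w : Word N d, (∏ p, C (w p) (e (lab₃ (J p)))) * ξ₃ w) := by
  symm
  calc ∑ J : Fin d → Fin m × Fin m × Fin m,
        (∑ u : Word N d, (∏ p, A (u p) (e (lab₁ (J p)))) * ξ₁ u) *
        (∑ v : Word N d, (∏ p, B (v p) (e (lab₂ (J p)))) * ξ₂ v) *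
        (∑ w : Word N d, (∏ p, C (w p) (e (lab₃ (J p)))) * ξ₃ w)
      = ∑ J : Fin d → Fin m × Fin m × Fin m, ∑ u : Word N d, ∑ v : Word N d, ∑ w : Word N d,
          (∏ p, A (u p) (e (lab₁ (J p)))) * ξ₁ u * ((∏ p, B (v p) (e (lab₂ (J p)))) * ξ₂ v) *
            ((∏ p, C (w p) (e (lab₃ (J p)))) * ξ₃ w) := by
        refine Finset.sum_congr rfl fun J _ => ?_
        rw [Finset.sum_mul_sum, Finset.sum_mul]
        refine Finset.sum_congr rfl fun u _ => ?_
        rw [Finset.sum_mul]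
        refine Finset.sum_congr rfl fun v _ => ?_
        rw [Finset.mul_sum]
    _ = ∑ u : Word N d, ∑ v : Word N d, ∑ w : Word N d, ∑ J : Fin d → Fin m × Fin m × Fin m,
          (∏ p, A (u p) (e (lab₁ (J p)))) * ξ₁ u * ((∏ p, B (v p) (e (lab₂ (J p)))) * ξ₂ v) *
            ((∏ p, C (w p) (e (lab₃ (J p)))) * ξ₃ w) := sum_comm₄' _
    _ = _ := by
        refine Finset.sum_congr rfl fun u _ => Finset.sum_congr rfl fun v _ =>
          Finset.sum_congr rfl fun w _ => ?_
        rw [kroneckerPow_actTensor_matMulRelabel_apply, triad_apply, Finset.sum_mul]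
        refine Finset.sum_congr rfl fun J _ => ?_
        rw [Finset.prod_mul_distrib, Finset.prod_mul_distrib]
        ring

end Expansion

/-! ## §2 Non-designs die by symmetry (as for the unit tensor) -/

section CommonColumn

variable {m N d : ℕ} {Y₁ Y₂ Y₃ : YoungDiagram}

/-- If two distinct positions `p ≠ q` lie in one column of each of three standard tableaux, the
expanded pairing of `((A⊗B⊗C)·⟨m,m,m⟩)^{⊗d}` with `e_{T₁} ⊗ e_{T₂} ⊗ e_{T₃}` vanishes: reindexing
`J ↦ J ∘ (p q)` produces the factor `(-1)³` (tree `sum_prod_mul_polytabloid_comp_swap`).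
[cite: BurgisserIkenmeyer2013, Thm. 4.1 and §4.2] -/
theorem tripleSumJ_eq_zero_of_common_column (e : Fin m × Fin m ≃ Fin N)
    (hN₁ : ∀ x ∈ Y₁.cells, x.1 < N) (hN₂ : ∀ x ∈ Y₂.cells, x.1 < N)
    (hN₃ : ∀ x ∈ Y₃.cells, x.1 < N) (T₁ : StdFilling d Y₁) (T₂ : StdFilling d Y₂)
    (T₃ : StdFilling d Y₃) {p q : Fin d} (hpq : p ≠ q)
    (h₁ : (T₁.1 p).2 = (T₁.1 q).2) (h₂ : (T₂.1 p).2 = (T₂.1 q).2) (h₃ : (T₃.1 p).2 = (T₃.1 q).2)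
    (A B C : Matrix (Fin N) (Fin N) ℂ) :
    ∑ J : Fin d → Fin m × Fin m × Fin m,
        (∑ u : Word N d, (∏ r, A (u r) (e (lab₁ (J r)))) * T₁.polytabloid ℂ hN₁ u) *
        (∑ v : Word N d, (∏ r, B (v r) (e (lab₂ (J r)))) * T₂.polytabloid ℂ hN₂ v) *
        (∑ w : Word N d, (∏ r, C (w r) (e (lab₃ (J r)))) * T₃.polytabloid ℂ hN₃ w) = 0 := by
  set τ : Equiv.Perm (Fin d) := Equiv.swap p q with hτ_def
  set S := ∑ J : Fin d → Fin m × Fin m × Fin m,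
        (∑ u : Word N d, (∏ r, A (u r) (e (lab₁ (J r)))) * T₁.polytabloid ℂ hN₁ u) *
        (∑ v : Word N d, (∏ r, B (v r) (e (lab₂ (J r)))) * T₂.polytabloid ℂ hN₂ v) *
        (∑ w : Word N d, (∏ r, C (w r) (e (lab₃ (J r)))) * T₃.polytabloid ℂ hN₃ w) with hS_def
  have hre : S = ∑ J : Fin d → Fin m × Fin m × Fin m,
      (∑ u : Word N d, (∏ r, A (u r) (e (lab₁ (J (τ r))))) * T₁.polytabloid ℂ hN₁ u) *
        (∑ v : Word N d, (∏ r, B (v r) (e (lab₂ (J (τ r))))) * T₂.polytabloid ℂ hN₂ v) *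
        (∑ w : Word N d, (∏ r, C (w r) (e (lab₃ (J (τ r))))) * T₃.polytabloid ℂ hN₃ w) := by
    rw [hS_def]
    refine Fintype.sum_equiv (Equiv.arrowCongr τ (Equiv.refl _)) _ _ fun J => ?_
    have hJ : ∀ r, ((Equiv.arrowCongr τ (Equiv.refl _)) J) (τ r) = J r := by
      intro r
      simp [Equiv.arrowCongr_apply]
    simp only [hJ]
  have hneg : S = -S := by
    nth_rewrite 1 [hre]
    rw [hS_def, ← Finset.sum_neg_distrib]
    refine Finset.sum_congr rfl fun J _ => ?_
    have e₁ := sum_prod_mul_polytabloid_comp_swap hN₁ T₁ hpq h₁ A (fun r => e (lab₁ (J r)))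
    have e₂ := sum_prod_mul_polytabloid_comp_swap hN₂ T₂ hpq h₂ B (fun r => e (lab₂ (J r)))
    have e₃ := sum_prod_mul_polytabloid_comp_swap hN₃ T₃ hpq h₃ C (fun r => e (lab₃ (J r)))
    rw [hτ_def, e₁, e₂, e₃]
    ring
  exact add_self_eq_zero.1 (by nth_rewrite 2 [hneg]; ring)

end CommonColumn

/-! ## §3 The elementary pairing of a hook polytabloid: arm entries of row `0` times a determinant -/

section HookPairing

variable {κ N d : ℕ}

/-- In the hook diagram `(κ+1, 1^{2κ})` a cell outside the first column lies in row `0`.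
[cite: BurgisserIkenmeyer2013, §4.4] -/
theorem fst_eq_zero_of_snd_ne_zero {x : ℕ × ℕ} (hx : x ∈ (bi2013Hook κ).youngDiagram)
    (h : x.2 ≠ 0) : x.1 = 0 := by
  rcases mem_youngDiagram_bi2013Hook.1 hx with ⟨h0, _⟩ | ⟨_, _, h2⟩
  · exact h0
  · exact absurd h2 h

/-- Rows of the hook diagram are `< 2κ + 1`. [cite: BurgisserIkenmeyer2013, §4.4] -/
theorem fst_lt_of_mem_youngDiagram_bi2013Hook' {x : ℕ × ℕ} (hx : x ∈ (bi2013Hook κ).youngDiagram) :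
    x.1 < 2 * κ + 1 := by
  rcases mem_youngDiagram_bi2013Hook.1 hx with ⟨h0, _⟩ | ⟨_, h1, _⟩
  · omega
  · exact h1

/-- The column stabiliser of a standard hook tableau consists of the permutations fixing every
position outside the first column (the other columns are singletons). Fulton, *Young Tableaux*,
§7.1. [cite: BurgisserIkenmeyer2013, §4.4] -/
theorem mem_colStab_hook_iff (T : StdFilling d (bi2013Hook κ).youngDiagram) (σ : Equiv.Perm (Fin d)) :
    σ ∈ T.colStab ↔ ∀ p, (T.1 p).2 ≠ 0 → σ p = p := by
  constructor
  · intro hσ p hp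
    have hcol := (StdFilling.mem_colStab.1 hσ) p
    apply T.injective
    refine Prod.ext ?_ hcol
    rw [fst_eq_zero_of_snd_ne_zero (T.mem _) (by rw [hcol]; exact hp),
      fst_eq_zero_of_snd_ne_zero (T.mem _) hp]
  · intro h
    refine StdFilling.mem_colStab.2 fun p => ?_
    by_cases hp : (T.1 p).2 = 0
    · -- `σ p` is again in the first column: otherwise `σ (σ p) = σ p`, so `σ p = p`
      rw [hp]
      by_contra hne
      have hfix : σ (σ p) = σ p := h (σ p) hne
      have hpp : σ p = p := σ.injective hfix
      rw [hpp] at hne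
      exact hne hp
    · rw [h p hp]

/-- **Step 1 of the evaluation of an elementary pairing**: pairing the decomposable word tensor
`⊗_p x_{c p}` (columns `c p` of `M`) with a polytabloid `e_T = ∑_{σ ∈ C_T} sgn(σ) e_{w_T ∘ σ⁻¹}`
gives `∑_{σ ∈ C_T} sgn(σ) ∏_p M_{w_T(σ⁻¹ p), c p}`. Fulton, *Young Tableaux*, §8.1.
[cite: BurgisserIkenmeyer2013, §4.2 (4.1)] -/
theorem sum_prod_mul_polytabloid_eq_sum_colStab {Y : YoungDiagram} (hN : ∀ x ∈ Y.cells, x.1 < N)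
    (T : StdFilling d Y) (M : Matrix (Fin N) (Fin N) ℂ) (c : Fin d → Fin N) :
    ∑ u : Word N d, (∏ p, M (u p) (c p)) * T.polytabloid ℂ hN u =
      ∑ σ ∈ T.colStab, ((Equiv.Perm.sign σ : ℤ) : ℂ) * ∏ p, M (T.rowWord hN (σ⁻¹ p)) (c p) := by
  simp_rw [StdFilling.polytabloid_apply, Finset.mul_sum]
  rw [Finset.sum_comm]
  refine Finset.sum_congr rfl fun σ _ => ?_
  rw [Finset.sum_eq_single (T.rowWord hN ∘ ⇑σ⁻¹)]
  · simp [mul_comm]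
  · intro u _ hu
    rw [if_neg hu, mul_zero]
  · intro h; exact absurd (Finset.mem_univ _) h

variable (hN : ∀ x ∈ (bi2013Hook κ).youngDiagram.cells, x.1 < N)
  (T : StdFilling (3 * κ + 1) (bi2013Hook κ).youngDiagram)

/-- The first column of a standard hook tableau, read by rows, is in bijection with the `2κ + 1`
rows (it contains every cell `(r, 0)`). [cite: BurgisserIkenmeyer2013, §4.4] -/
theorem rowWord_bijective_on_col (hNeq : N = 2 * κ + 1) :
    Function.Bijective (fun q : {p : Fin (3 * κ + 1) // (T.1 p).2 = 0} => T.rowWord hN q.1) := by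
  constructor
  · rintro ⟨q, hq⟩ ⟨q', hq'⟩ h
    have hrow : (T.1 q).1 = (T.1 q').1 := by
      have := congrArg Fin.val h
      simpa [StdFilling.rowWord_val] using this
    exact Subtype.ext (T.injective (Prod.ext hrow (hq.trans hq'.symm)))
  · intro r
    have hd : (bi2013Hook κ).youngDiagram.cells.card = 3 * κ + 1 :=
      Nat.Partition.card_cells_youngDiagram _
    obtain ⟨p, hp⟩ := T.exists_eq hd (mk_zero_mem_youngDiagram_bi2013Hook (r := r.1) (by omega))
    refine ⟨⟨p, by rw [hp]⟩, Fin.ext ?_⟩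
    simp [StdFilling.rowWord_val, hp]

/-- The bijection "first column of `T` ≃ rows". [cite: BurgisserIkenmeyer2013, §4.4] -/
def colEquiv (hNeq : N = 2 * κ + 1) : {p : Fin (3 * κ + 1) // (T.1 p).2 = 0} ≃ Fin N :=
  Equiv.ofBijective _ (rowWord_bijective_on_col hN T hNeq)

/-- Unfolding lemma for `colEquiv`. [folklore] -/
private theorem colEquiv_apply (hNeq : N = 2 * κ + 1) (q : {p : Fin (3 * κ + 1) // (T.1 p).2 = 0}) :
    colEquiv hN T hNeq q = T.rowWord hN q.1 := rfl

/-- The sign attached to a column labeling `c` of the positions by letters: the determinant of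
the `0/1` matrix `(1)_{i, c(q_j)}` where `q_j` is the first-column position of row `j`
(`= sgn` of `c` restricted to the first column if that restriction is a bijection onto the
letters, and `0` otherwise). [cite: BurgisserIkenmeyer2013, §4.2 (4.1)] -/
def colSign (hNeq : N = 2 * κ + 1) (c : Fin (3 * κ + 1) → Fin N) : ℂ :=
  ((1 : Matrix (Fin N) (Fin N) ℂ).submatrix id (c ∘ Subtype.val ∘ (colEquiv hN T hNeq).symm)).det

/-- The letter `0` = the row index of the arm boxes of the hook (needs `N ≥ 1`).
[cite: BurgisserIkenmeyer2013, §4.4] -/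
def letterZero (hNeq : N = 2 * κ + 1) : Fin N := ⟨0, by omega⟩

/-- Arm positions carry the letter `0` in the row word. [cite: BurgisserIkenmeyer2013, §4.4] -/
theorem rowWord_eq_letterZero (hNeq : N = 2 * κ + 1) {p : Fin (3 * κ + 1)} (hp : (T.1 p).2 ≠ 0) :
    T.rowWord hN p = letterZero hNeq := by
  apply Fin.ext
  rw [StdFilling.rowWord_val, letterZero, fst_eq_zero_of_snd_ne_zero (T.mem p) hp]

/-- **Step 2**: the signed sum over the column stabiliser of a hook tableau, restricted to the
first column, is a determinant: `∑_{σ ∈ C_T} sgn σ ∏_{q ∈ col₀} M_{w_T(σ⁻¹ q), c q} = det(M_{w_T q, c q'})_{q,q' ∈ col₀}`.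
[cite: BurgisserIkenmeyer2013, §4.2 (4.1)] -/
theorem sum_colStab_prod_col_eq_det (M : Matrix (Fin N) (Fin N) ℂ) (c : Fin (3 * κ + 1) → Fin N) :
    ∑ σ ∈ T.colStab, ((Equiv.Perm.sign σ : ℤ) : ℂ) *
        ∏ q : {p : Fin (3 * κ + 1) // (T.1 p).2 = 0}, M (T.rowWord hN (σ⁻¹ q.1)) (c q.1) =
      (Matrix.of fun q q' : {p : Fin (3 * κ + 1) // (T.1 p).2 = 0} =>
        M (T.rowWord hN q.1) (c q'.1)).det := by
  classical
  -- the column stabiliser is the set of permutations fixing the arm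
  have hC : T.colStab = Finset.univ.filter
      (fun σ : Equiv.Perm (Fin (3 * κ + 1)) => ∀ a, ¬ (T.1 a).2 = 0 → σ a = a) := by
    ext σ
    simp only [Finset.mem_filter, Finset.mem_univ, true_and]
    exact mem_colStab_hook_iff T σ
  set P' : Equiv.Perm (Fin (3 * κ + 1)) → Prop := fun σ => ∀ a, ¬ (T.1 a).2 = 0 → σ a = a
    with hP'
  rw [hC, Finset.sum_subtype (Finset.univ.filter P') (p := P') (fun σ => by simp)]
  -- transport to permutations of the subtype "first column"
  set S := {p : Fin (3 * κ + 1) // (T.1 p).2 = 0}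
  set Q : Matrix S S ℂ := Matrix.of fun q q' : S => M (T.rowWord hN q.1) (c q'.1) with hQ
  have step : ∑ σ : {σ : Equiv.Perm (Fin (3 * κ + 1)) // P' σ},
      ((Equiv.Perm.sign σ.1 : ℤ) : ℂ) * ∏ q : S, M (T.rowWord hN ((σ.1)⁻¹ q.1)) (c q.1) =
      ∑ τ : Equiv.Perm S, ((Equiv.Perm.sign τ : ℤ) : ℂ) * ∏ q : S, Q (τ⁻¹ q) q := by
    rw [← Equiv.sum_comp (Equiv.Perm.subtypeEquivSubtypePerm (fun a : Fin (3 * κ + 1) => (T.1 a).2 = 0))]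
    refine Finset.sum_congr rfl fun τ _ => ?_
    have h1 : ((Equiv.Perm.subtypeEquivSubtypePerm (fun a : Fin (3 * κ + 1) => (T.1 a).2 = 0)) τ).1 =
        Equiv.Perm.ofSubtype τ := rfl
    rw [h1, Equiv.Perm.sign_ofSubtype, ← map_inv]
    congr 1
    refine Finset.prod_congr rfl fun q _ => ?_
    rw [Equiv.Perm.ofSubtype_apply_coe, hQ, Matrix.of_apply]
  rw [step, Matrix.det_apply']
  -- reindex `τ ↦ τ⁻¹`
  refine Fintype.sum_equiv (Equiv.inv (Equiv.Perm S)) _ _ fun τ => ?_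
  change _ = ((Equiv.Perm.sign τ⁻¹ : ℤ) : ℂ) * ∏ q, Q (τ⁻¹ q) q
  rw [Equiv.Perm.sign_inv]

/-- **Step 3**: the first-column determinant is `det M` times the sign `colSign` of the labeling
(`Q = (M·𝟙_{·,c})` reindexed along `colEquiv`). [cite: BurgisserIkenmeyer2013, §4.2 (4.1)] -/
theorem det_colMatrix_eq (hNeq : N = 2 * κ + 1) (M : Matrix (Fin N) (Fin N) ℂ)
    (c : Fin (3 * κ + 1) → Fin N) :
    (Matrix.of fun q q' : {p : Fin (3 * κ + 1) // (T.1 p).2 = 0} =>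
        M (T.rowWord hN q.1) (c q'.1)).det = M.det * colSign hN T hNeq c := by
  classical
  set ρ := colEquiv hN T hNeq with hρ
  set g : Fin N → Fin N := c ∘ Subtype.val ∘ ρ.symm with hg
  have hQ : (Matrix.of fun q q' : {p : Fin (3 * κ + 1) // (T.1 p).2 = 0} =>
        M (T.rowWord hN q.1) (c q'.1)) = (M.submatrix id g).submatrix ρ ρ := by
    ext q q'
    simp only [Matrix.of_apply, Matrix.submatrix_apply, id_eq, hg, Function.comp_apply,
      Equiv.symm_apply_apply]
    rfl
  have hmul : M.submatrix id g = M * (1 : Matrix (Fin N) (Fin N) ℂ).submatrix id g := by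
    ext i j
    simp [Matrix.mul_apply, Matrix.one_apply]
  rw [hQ, Matrix.det_submatrix_equiv_self, hmul, Matrix.det_mul, colSign]

/-- **The elementary pairing of a hook polytabloid, evaluated** (BI 2013, (4.1) with §4.4: the
hyperedges of `H_κ` in one layer are ONE set of size `2κ + 1 = N` — a full determinant — and
`κ` singletons — entries of the first row): for a standard tableau `T` of shape
`(κ+1, 1^{2κ})` on alphabet size `N = 2κ + 1`,
`⟨⊗_p x_{c p}, e_T⟩ = (∏_{p ∈ arm T} M_{0, c p}) · det M · colSign_T(c)`.
So it depends on `M` only through its first row and its determinant.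
[cite: BurgisserIkenmeyer2013, §4.2 (4.1) and §6.2] -/
theorem hook_pairing_eq (hNeq : N = 2 * κ + 1) (M : Matrix (Fin N) (Fin N) ℂ)
    (c : Fin (3 * κ + 1) → Fin N) :
    ∑ u : Word N (3 * κ + 1), (∏ p, M (u p) (c p)) * T.polytabloid ℂ hN u =
      (∏ p ∈ Finset.univ.filter (fun p => ¬ (T.1 p).2 = 0), M (letterZero hNeq) (c p)) *
        (M.det * colSign hN T hNeq c) := by
  classical
  rw [sum_prod_mul_polytabloid_eq_sum_colStab, ← det_colMatrix_eq hN T hNeq M c,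
    ← sum_colStab_prod_col_eq_det hN T M c, Finset.mul_sum]
  refine Finset.sum_congr rfl fun σ hσ => ?_
  have hfix : ∀ p, ¬ (T.1 p).2 = 0 → σ⁻¹ p = p :=
    (mem_colStab_hook_iff T σ⁻¹).1 (StdFilling.inv_mem_colStab hσ)
  rw [← Finset.prod_filter_mul_prod_filter_not Finset.univ (fun p => ¬ (T.1 p).2 = 0)]
  have harm : ∏ p ∈ Finset.univ.filter (fun p => ¬ (T.1 p).2 = 0), M (T.rowWord hN (σ⁻¹ p)) (c p) =
      ∏ p ∈ Finset.univ.filter (fun p => ¬ (T.1 p).2 = 0), M (letterZero hNeq) (c p) := by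
    refine Finset.prod_congr rfl fun p hp => ?_
    simp only [Finset.mem_filter, Finset.mem_univ, true_and] at hp
    rw [hfix p hp, rowWord_eq_letterZero hN T hNeq hp]
  have hcol : ∏ p ∈ Finset.univ.filter (fun p => ¬¬ (T.1 p).2 = 0), M (T.rowWord hN (σ⁻¹ p)) (c p) =
      ∏ q : {p : Fin (3 * κ + 1) // (T.1 p).2 = 0}, M (T.rowWord hN (σ⁻¹ q.1)) (c q.1) := by
    refine Finset.prod_subtype _ (fun p => ?_) (fun p => M (T.rowWord hN (σ⁻¹ p)) (c p))
    simp
  rw [harm, hcol]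
  ring

end HookPairing




/-! ## §4 Factorisation: the pairing depends on `A, B, C` only through their determinants and first rows -/

section Factorisation

variable {κ N m : ℕ} (e : Fin m × Fin m ≃ Fin N)
  (hN : ∀ x ∈ (bi2013Hook κ).youngDiagram.cells, x.1 < N) (hNeq : N = 2 * κ + 1)
  (T₁ T₂ T₃ : StdFilling (3 * κ + 1) (bi2013Hook κ).youngDiagram)

/-- The arm of a hook tableau: the positions outside its first column. [cite: BurgisserIkenmeyer2013, §6 (the sets `V^(k)`)] -/
abbrev arm (T : StdFilling (3 * κ + 1) (bi2013Hook κ).youngDiagram) : Finset (Fin (3 * κ + 1)) :=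
  Finset.univ.filter fun p => ¬ (T.1 p).2 = 0

/-- **The first-row form `G`** of the pairing (refute-g25 README, step 2): for three row vectors
`x, y, z ∈ ℂ^N`,
`G(x,y,z) = ∑_J colSign₁(J) colSign₂(J) colSign₃(J) ∏_{arm₁} x_{lab₁ J} ∏_{arm₂} y_{lab₂ J} ∏_{arm₃} z_{lab₃ J}`.
[cite: BurgisserIkenmeyer2013, §6.2–6.3] -/
def armG (x y z : Fin N → ℂ) : ℂ :=
  ∑ J : Fin (3 * κ + 1) → Fin m × Fin m × Fin m,
    colSign hN T₁ hNeq (fun p => e (lab₁ (J p))) * colSign hN T₂ hNeq (fun p => e (lab₂ (J p))) *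
      colSign hN T₃ hNeq (fun p => e (lab₃ (J p))) *
      ((∏ p ∈ arm T₁, x (e (lab₁ (J p)))) * (∏ p ∈ arm T₂, y (e (lab₂ (J p)))) *
        (∏ p ∈ arm T₃, z (e (lab₃ (J p)))))

/-- **Factorisation** (refute-g25 README, step 2; BI 2013 §6.2: "`f_H(A MaMu_m)` is a sum of
products of determinants of submatrices of the `A^(k)`" — here the submatrices are the WHOLE
matrices and first-row entries):
`∑_J ⟨⊗ a_{lab₁J}, e_{T₁}⟩⟨⊗ b_{lab₂J}, e_{T₂}⟩⟨⊗ c_{lab₃J}, e_{T₃}⟩ = det A · det B · det C · G(A₀, B₀, C₀)`.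
[cite: BurgisserIkenmeyer2013, §6.2] -/
theorem tripleSumJ_eq_det_mul_armG (A B C : Matrix (Fin N) (Fin N) ℂ) :
    ∑ J : Fin (3 * κ + 1) → Fin m × Fin m × Fin m,
        (∑ u : Word N (3 * κ + 1), (∏ r, A (u r) (e (lab₁ (J r)))) * T₁.polytabloid ℂ hN u) *
        (∑ v : Word N (3 * κ + 1), (∏ r, B (v r) (e (lab₂ (J r)))) * T₂.polytabloid ℂ hN v) *
        (∑ w : Word N (3 * κ + 1), (∏ r, C (w r) (e (lab₃ (J r)))) * T₃.polytabloid ℂ hN w) =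
      A.det * B.det * C.det *
        armG e hN hNeq T₁ T₂ T₃ (fun a => A (letterZero hNeq) a) (fun a => B (letterZero hNeq) a)
          (fun a => C (letterZero hNeq) a) := by
  simp only [hook_pairing_eq hN _ hNeq, armG, Finset.mul_sum]
  refine Finset.sum_congr rfl fun J _ => ?_
  ring

/-- If every term of `G` has a vanishing arm product in the first slot (e.g. `x = 0` and the arm
is non-empty) then `G = 0`; same for the other slots. [folklore] -/
private theorem armG_eq_zero_of_arm_prod (x y z : Fin N → ℂ)
    (h : ∀ J : Fin (3 * κ + 1) → Fin m × Fin m × Fin m,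
      (∏ p ∈ arm T₁, x (e (lab₁ (J p)))) * (∏ p ∈ arm T₂, y (e (lab₂ (J p)))) *
        (∏ p ∈ arm T₃, z (e (lab₃ (J p)))) = 0) :
    armG e hN hNeq T₁ T₂ T₃ x y z = 0 := by
  refine Finset.sum_eq_zero fun J _ => ?_
  rw [h J, mul_zero]

end Factorisation

/-! ## §5 The stabiliser `GL_m³` of `⟨m,m,m⟩` and the invariance of `G` -/

section Stabiliser

variable {κ N m : ℕ} (e : Fin m × Fin m ≃ Fin N)

/-- A Kronecker matrix on `Fin m × Fin m`, moved to the alphabet `Fin N` along `e`. [folklore] -/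
abbrev kronRelabel (g k : Matrix (Fin m) (Fin m) ℂ) : Matrix (Fin N) (Fin N) ℂ :=
  (g ⊗ₖ k).submatrix e.symm e.symm

/-- **`GL(E) × GL(F) × GL(G)` stabilises `⟨m,m,m⟩`** (BI 2011, Prop. 5.1; here in the inverse-free
form: if `g g'ᵀ = 1`, `h h'ᵀ = 1`, `k k'ᵀ = 1` then `((g⊗k) ⊗ (g'⊗h) ⊗ (h'⊗k'))·⟨m,m,m⟩ = ⟨m,m,m⟩`).
[cite: BurgisserIkenmeyer2011, Prop. 5.1] -/
theorem actTensor_kronRelabel_matMulRelabel (g g' h h' k k' : Matrix (Fin m) (Fin m) ℂ)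
    (hg : g * g'ᵀ = 1) (hh : h * h'ᵀ = 1) (hk : k * k'ᵀ = 1) :
    actTensor (kronRelabel e g k) (kronRelabel e g' h) (kronRelabel e h' k') (matMulRelabel m N e) =
      matMulRelabel m N e := by
  funext a b c
  rw [actTensor_matMulRelabel_apply]
  have key : ∀ x : Fin m × Fin m × Fin m,
      kronRelabel e g k a (e (lab₁ x)) * kronRelabel e g' h b (e (lab₂ x)) *
          kronRelabel e h' k' c (e (lab₃ x)) =
        (g (e.symm a).1 x.1 * g' (e.symm b).1 x.1) *
          ((h (e.symm b).2 x.2.1 * h' (e.symm c).1 x.2.1) *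
            (k (e.symm a).2 x.2.2 * k' (e.symm c).2 x.2.2)) := by
    intro x
    simp only [kronRelabel, Matrix.submatrix_apply, Equiv.symm_apply_apply,
      Matrix.kroneckerMap_apply, lab₁, lab₂, lab₃]
    ring
  simp only [key]
  rw [Fintype.sum_prod_type]
  simp only [Fintype.sum_prod_type (γ := ℂ)]
  have h3 : ∀ (F : Fin m → ℂ) (G : Fin m → ℂ) (H : Fin m → ℂ),
      ∑ i, ∑ j, ∑ l, F i * (G j * H l) = (∑ i, F i) * ((∑ j, G j) * ∑ l, H l) := by
    intro F G H
    have hGH : (∑ j, G j) * ∑ l, H l = ∑ j, ∑ l, G j * H l := Finset.sum_mul_sum _ _ _ _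
    rw [hGH, Finset.sum_mul]
    refine Finset.sum_congr rfl fun i _ => ?_
    rw [Finset.mul_sum]
    refine Finset.sum_congr rfl fun j _ => ?_
    rw [Finset.mul_sum]
  rw [h3]
  have e1 : ∑ i, g (e.symm a).1 i * g' (e.symm b).1 i = (g * g'ᵀ) (e.symm a).1 (e.symm b).1 := by
    rw [Matrix.mul_apply]; rfl
  have e2 : ∑ j, h (e.symm b).2 j * h' (e.symm c).1 j = (h * h'ᵀ) (e.symm b).2 (e.symm c).1 := by
    rw [Matrix.mul_apply]; rfl
  have e3 : ∑ l, k (e.symm a).2 l * k' (e.symm c).2 l = (k * k'ᵀ) (e.symm a).2 (e.symm c).2 := by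
    rw [Matrix.mul_apply]; rfl
  rw [e1, e2, e3, hg, hh, hk]
  simp only [Matrix.one_apply, matMulRelabel, matMulTensor]
  by_cases h₁ : (e.symm a).1 = (e.symm b).1 <;> by_cases h₂ : (e.symm b).2 = (e.symm c).1 <;>
    by_cases h₃ : (e.symm a).2 = (e.symm c).2 <;> simp [h₁, h₂, h₃]

/-- The three Kronecker determinants of a stabiliser element multiply to `1`
(`det(g⊗k) det(g'⊗h) det(h'⊗k') = (det g det g')^m (det h det h')^m (det k det k')^m`).
[cite: BurgisserIkenmeyer2011, Prop. 5.1] -/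
theorem det_kronRelabel_mul (g g' h h' k k' : Matrix (Fin m) (Fin m) ℂ)
    (hg : g * g'ᵀ = 1) (hh : h * h'ᵀ = 1) (hk : k * k'ᵀ = 1) :
    (kronRelabel e g k).det * (kronRelabel e g' h).det * (kronRelabel e h' k').det = 1 := by
  have dg : g.det * g'.det = 1 := by
    rw [← Matrix.det_transpose g', ← Matrix.det_mul, hg, Matrix.det_one]
  have dh : h.det * h'.det = 1 := by
    rw [← Matrix.det_transpose h', ← Matrix.det_mul, hh, Matrix.det_one]
  have dk : k.det * k'.det = 1 := by
    rw [← Matrix.det_transpose k', ← Matrix.det_mul, hk, Matrix.det_one]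
  simp only [kronRelabel, Matrix.det_submatrix_equiv_self, Matrix.det_kronecker, Fintype.card_fin]
  calc g.det ^ m * k.det ^ m * (g'.det ^ m * h.det ^ m) * (h'.det ^ m * k'.det ^ m)
      = (g.det * g'.det) ^ m * (h.det * h'.det) ^ m * (k.det * k'.det) ^ m := by ring
    _ = 1 := by rw [dg, dh, dk]; simp

/-- A nonzero row vector is the first row of an invertible matrix. [folklore] -/
private theorem exists_matrix_row_det_ne_zero (r₀ : Fin N) (x : Fin N → ℂ) (hx : x ≠ 0) :
    ∃ A : Matrix (Fin N) (Fin N) ℂ, (fun a => A r₀ a) = x ∧ A.det ≠ 0 := by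
  classical
  obtain ⟨a₀, ha₀⟩ : ∃ a₀, x a₀ ≠ 0 := by
    by_contra h
    push Not at h
    exact hx (funext h)
  set σ : Equiv.Perm (Fin N) := Equiv.swap r₀ a₀ with hσ
  refine ⟨((1 : Matrix (Fin N) (Fin N) ℂ).updateRow r₀ (x ∘ σ)).submatrix id σ, ?_, ?_⟩
  · funext a
    simp [Matrix.submatrix_apply, Matrix.updateRow_self, hσ, Equiv.swap_apply_self]
  · have hv : (x ∘ σ) = ∑ j, (x ∘ σ) j • (1 : Matrix (Fin N) (Fin N) ℂ) j := by
      funext i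
      simp [Finset.sum_apply, Matrix.one_apply, Pi.smul_apply]
    rw [Matrix.det_permute', hv, Matrix.det_updateRow_sum, Matrix.det_one]
    simp [hσ, ha₀]

variable (hN : ∀ x ∈ (bi2013Hook κ).youngDiagram.cells, x.1 < N) (hNeq : N = 2 * κ + 1)
  (T₁ T₂ T₃ : StdFilling (3 * κ + 1) (bi2013Hook κ).youngDiagram)

include hN hNeq in
/-- The arm of a hook tableau on `3κ + 1` positions (alphabet `2κ + 1`) has `κ` elements.
[cite: BurgisserIkenmeyer2013, §6 (`|V^(k)| = κ`)] -/
theorem card_arm (T : StdFilling (3 * κ + 1) (bi2013Hook κ).youngDiagram) : (arm T).card = κ := by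
  classical
  have hcol : (Finset.univ.filter fun p : Fin (3 * κ + 1) => (T.1 p).2 = 0).card = 2 * κ + 1 := by
    rw [← hNeq, ← Fintype.card_fin N, ← Fintype.card_congr (colEquiv hN T hNeq), Fintype.card_subtype]
  have h := Finset.card_filter_add_card_filter_not
    (s := (Finset.univ : Finset (Fin (3 * κ + 1)))) (fun p => (T.1 p).2 = 0)
  rw [hcol, Finset.card_univ, Fintype.card_fin] at h
  simp only [arm]
  omega

/-- **Stabiliser invariance of the pairing**: `P(A·R₁, B·R₂, C·R₃) = P(A, B, C)` for a stabiliser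
element `(R₁, R₂, R₃)` of `⟨m,m,m⟩`. [cite: BurgisserIkenmeyer2011, Prop. 5.1] -/
theorem tripleSumJ_mul_stabiliser (g g' h h' k k' : Matrix (Fin m) (Fin m) ℂ)
    (hg : g * g'ᵀ = 1) (hh : h * h'ᵀ = 1) (hk : k * k'ᵀ = 1) (A B C : Matrix (Fin N) (Fin N) ℂ) :
    ∑ J : Fin (3 * κ + 1) → Fin m × Fin m × Fin m,
        (∑ u : Word N (3 * κ + 1), (∏ r, (A * kronRelabel e g k) (u r) (e (lab₁ (J r)))) *
          T₁.polytabloid ℂ hN u) *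
        (∑ v : Word N (3 * κ + 1), (∏ r, (B * kronRelabel e g' h) (v r) (e (lab₂ (J r)))) *
          T₂.polytabloid ℂ hN v) *
        (∑ w : Word N (3 * κ + 1), (∏ r, (C * kronRelabel e h' k') (w r) (e (lab₃ (J r)))) *
          T₃.polytabloid ℂ hN w) =
    ∑ J : Fin (3 * κ + 1) → Fin m × Fin m × Fin m,
        (∑ u : Word N (3 * κ + 1), (∏ r, A (u r) (e (lab₁ (J r)))) * T₁.polytabloid ℂ hN u) *
        (∑ v : Word N (3 * κ + 1), (∏ r, B (v r) (e (lab₂ (J r)))) * T₂.polytabloid ℂ hN v) *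
        (∑ w : Word N (3 * κ + 1), (∏ r, C (w r) (e (lab₃ (J r)))) * T₃.polytabloid ℂ hN w) := by
  rw [← pairing_matMulRelabel_eq_sum, ← pairing_matMulRelabel_eq_sum, ← actTensor_actTensor,
    actTensor_kronRelabel_matMulRelabel e g g' h h' k k' hg hh hk]

/-- **`G` is invariant under `GL(E) × GL(F) × GL(G)`** (refute-g25 README, step 3): for a
stabiliser element as above, `G(x·R₁, y·R₂, z·R₃) = G(x, y, z)` (`κ ≥ 1`).
[cite: BurgisserIkenmeyer2011, Prop. 5.1] -/
theorem armG_vecMul_stabiliser (hκ : 1 ≤ κ) (g g' h h' k k' : Matrix (Fin m) (Fin m) ℂ)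
    (hg : g * g'ᵀ = 1) (hh : h * h'ᵀ = 1) (hk : k * k'ᵀ = 1) (x y z : Fin N → ℂ) :
    armG e hN hNeq T₁ T₂ T₃ (x ᵥ* kronRelabel e g k) (y ᵥ* kronRelabel e g' h)
        (z ᵥ* kronRelabel e h' k') = armG e hN hNeq T₁ T₂ T₃ x y z := by
  classical
  -- degenerate cases: a zero row vector kills both sides (arms are non-empty)
  have harm : ∀ T : StdFilling (3 * κ + 1) (bi2013Hook κ).youngDiagram, (arm T).Nonempty := by
    intro T
    rw [← Finset.card_pos, card_arm hN hNeq T]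
    exact hκ
  have zero_case : ∀ (x' y' z' : Fin N → ℂ), x' = 0 ∨ y' = 0 ∨ z' = 0 →
      armG e hN hNeq T₁ T₂ T₃ x' y' z' = 0 := by
    intro x' y' z' h0
    refine armG_eq_zero_of_arm_prod e hN hNeq T₁ T₂ T₃ x' y' z' fun J => ?_
    rcases h0 with rfl | rfl | rfl
    · obtain ⟨p, hp⟩ := harm T₁
      rw [Finset.prod_eq_zero hp (by simp), zero_mul, zero_mul]
    · obtain ⟨p, hp⟩ := harm T₂
      rw [Finset.prod_eq_zero hp (by simp), mul_zero, zero_mul]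
    · obtain ⟨p, hp⟩ := harm T₃
      rw [Finset.prod_eq_zero hp (by simp), mul_zero]
  by_cases hx : x = 0
  · rw [zero_case _ _ _ (Or.inl hx), zero_case _ _ _ (Or.inl (by rw [hx, Matrix.zero_vecMul]))]
  by_cases hy : y = 0
  · rw [zero_case _ _ _ (Or.inr (Or.inl hy)),
      zero_case _ _ _ (Or.inr (Or.inl (by rw [hy, Matrix.zero_vecMul])))]
  by_cases hz : z = 0
  · rw [zero_case _ _ _ (Or.inr (Or.inr hz)),
      zero_case _ _ _ (Or.inr (Or.inr (by rw [hz, Matrix.zero_vecMul])))]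
  -- generic case: realise the rows by invertible matrices and use the stabiliser invariance
  obtain ⟨A, hAx, hA⟩ := exists_matrix_row_det_ne_zero (letterZero hNeq) x hx
  obtain ⟨B, hBy, hB⟩ := exists_matrix_row_det_ne_zero (letterZero hNeq) y hy
  obtain ⟨C, hCz, hC⟩ := exists_matrix_row_det_ne_zero (letterZero hNeq) z hz
  have key := tripleSumJ_mul_stabiliser e hN T₁ T₂ T₃ g g' h h' k k' hg hh hk A B C
  rw [tripleSumJ_eq_det_mul_armG e hN hNeq T₁ T₂ T₃, tripleSumJ_eq_det_mul_armG e hN hNeq T₁ T₂ T₃,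
    Matrix.det_mul, Matrix.det_mul, Matrix.det_mul] at key
  have hrow : ∀ (M R : Matrix (Fin N) (Fin N) ℂ),
      (fun a => (M * R) (letterZero hNeq) a) = (fun a => M (letterZero hNeq) a) ᵥ* R := by
    intro M R
    funext a
    simp [Matrix.mul_apply, Matrix.vecMul, dotProduct]
  rw [hrow, hrow, hrow, hAx, hBy, hCz] at key
  have hdet := det_kronRelabel_mul e g g' h h' k k' hg hh hk
  have hABC : A.det * B.det * C.det ≠ 0 := mul_ne_zero (mul_ne_zero hA hB) hC
  have key' : A.det * B.det * C.det *
      ((kronRelabel e g k).det * (kronRelabel e g' h).det * (kronRelabel e h' k').det) *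
      armG e hN hNeq T₁ T₂ T₃ (x ᵥ* kronRelabel e g k) (y ᵥ* kronRelabel e g' h)
        (z ᵥ* kronRelabel e h' k') =
      A.det * B.det * C.det * armG e hN hNeq T₁ T₂ T₃ x y z := by
    rw [← key]; ring
  rw [hdet, mul_one] at key'
  exact mul_left_cancel₀ hABC key'

end Stabiliser


/-! ## §6 Normal forms: `(X, Y, Z) ~ (X Zᵀ Yᵀ, 1, 1)` and conjugation of the first slot -/

section NormalForm

variable {κ N m : ℕ} (e : Fin m × Fin m ≃ Fin N)

/-- A row vector on the alphabet `Fin N ≃ Fin m × Fin m` read as an `m × m` matrix, and back.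
[folklore] -/
def vecOf (X : Matrix (Fin m) (Fin m) ℂ) : Fin N → ℂ := fun a => X (e.symm a).1 (e.symm a).2

/-- Every row vector is `vecOf` of its matrix. [folklore] -/
private theorem vecOf_matOf (x : Fin N → ℂ) : vecOf e (Matrix.of fun i j => x (e (i, j))) = x := by
  funext a
  simp [vecOf]

/-- The stabiliser acts on first rows by `X ↦ gᵀ X k`. [cite: BurgisserIkenmeyer2011, Prop. 5.1] -/
theorem vecOf_vecMul_kronRelabel (X g k : Matrix (Fin m) (Fin m) ℂ) :
    vecOf e X ᵥ* kronRelabel e g k = vecOf e (gᵀ * X * k) := by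
  funext b
  simp only [Matrix.vecMul, dotProduct, vecOf, kronRelabel, Matrix.submatrix_apply,
    Matrix.kroneckerMap_apply]
  rw [← Equiv.sum_comp e]
  simp only [Equiv.symm_apply_apply, Fintype.sum_prod_type, Matrix.mul_apply,
    Matrix.transpose_apply, Finset.sum_mul]
  rw [Finset.sum_comm]
  refine Finset.sum_congr rfl fun j _ => Finset.sum_congr rfl fun i _ => ?_
  ring

variable (hN : ∀ x ∈ (bi2013Hook κ).youngDiagram.cells, x.1 < N) (hNeq : N = 2 * κ + 1)
  (T₁ T₂ T₃ : StdFilling (3 * κ + 1) (bi2013Hook κ).youngDiagram)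

/-- **Normal form I** (refute-g25 README, step 4): for invertible `Y, Z`,
`G(X, Y, Z) = G(X Zᵀ Yᵀ, 1, 1)`. [cite: BurgisserIkenmeyer2011, Prop. 5.1] -/
theorem armG_eq_armG_mul_one_one (hκ : 1 ≤ κ) (X Y Z : Matrix (Fin m) (Fin m) ℂ)
    (hY : IsUnit Y.det) (hZ : IsUnit Z.det) :
    armG e hN hNeq T₁ T₂ T₃ (vecOf e X) (vecOf e Y) (vecOf e Z) =
      armG e hN hNeq T₁ T₂ T₃ (vecOf e (X * Zᵀ * Yᵀ)) (vecOf e 1) (vecOf e 1) := by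
  have key := armG_vecMul_stabiliser e hN hNeq T₁ T₂ T₃ hκ 1 1 Y⁻¹ Yᵀ (Zᵀ * Yᵀ) (Z⁻¹ * Y⁻¹)
    (by simp) (by rw [Matrix.transpose_transpose, Matrix.nonsing_inv_mul Y hY])
    (by
      rw [Matrix.transpose_mul, Matrix.transpose_nonsing_inv, Matrix.transpose_nonsing_inv,
        Matrix.mul_assoc, ← Matrix.mul_assoc Yᵀ, Matrix.mul_nonsing_inv Yᵀ
          (by rwa [Matrix.det_transpose]), Matrix.one_mul,
        Matrix.mul_nonsing_inv Zᵀ (by rwa [Matrix.det_transpose])])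
    (vecOf e X) (vecOf e Y) (vecOf e Z)
  rw [vecOf_vecMul_kronRelabel, vecOf_vecMul_kronRelabel, vecOf_vecMul_kronRelabel] at key
  rw [← key]
  congr 2
  · rw [Matrix.transpose_one, Matrix.one_mul, Matrix.mul_assoc]
  · rw [Matrix.transpose_one, Matrix.one_mul, Matrix.mul_nonsing_inv Y hY]
  · rw [Matrix.transpose_transpose, ← Matrix.mul_assoc, Matrix.mul_assoc Y Z,
      Matrix.mul_nonsing_inv Z hZ, Matrix.mul_one, Matrix.mul_nonsing_inv Y hY]

/-- **Normal form II** (refute-g25 README, step 4): with `Y = Z = 1` the first slot may be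
conjugated, `G(M, 1, 1) = G(S M S⁻¹, 1, 1)`. [cite: BurgisserIkenmeyer2011, Prop. 5.1] -/
theorem armG_conj (hκ : 1 ≤ κ) (M S : Matrix (Fin m) (Fin m) ℂ) (hS : IsUnit S.det) :
    armG e hN hNeq T₁ T₂ T₃ (vecOf e M) (vecOf e 1) (vecOf e 1) =
      armG e hN hNeq T₁ T₂ T₃ (vecOf e (S * M * S⁻¹)) (vecOf e 1) (vecOf e 1) := by
  have h1 : Sᵀ * S⁻¹ᵀ = 1 := by
    rw [← Matrix.transpose_mul, Matrix.nonsing_inv_mul S hS, Matrix.transpose_one]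
  have h2 : S⁻¹ * Sᵀᵀ = 1 := by
    rw [Matrix.transpose_transpose, Matrix.nonsing_inv_mul S hS]
  have key := armG_vecMul_stabiliser e hN hNeq T₁ T₂ T₃ hκ Sᵀ S⁻¹ Sᵀ S⁻¹ S⁻¹ Sᵀ h1 h1 h2
    (vecOf e M) (vecOf e 1) (vecOf e 1)
  simp only [vecOf_vecMul_kronRelabel] at key
  have hY' : S⁻¹ᵀ * (1 : Matrix (Fin m) (Fin m) ℂ) * Sᵀ = 1 := by
    rw [Matrix.mul_one, ← Matrix.transpose_mul, Matrix.mul_nonsing_inv S hS, Matrix.transpose_one]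
  rw [Matrix.transpose_transpose, hY'] at key
  exact key.symm

end NormalForm

/-! ## §7 Triangularisation over `ℂ` (Schur): every square matrix is conjugate to an upper triangular one -/

section Schur

/-- Every complex square matrix has an eigenvector (Mathlib: `Module.End.exists_eigenvalue`).
[folklore] -/
private theorem exists_eigenvector {n : ℕ} (M : Matrix (Fin (n + 1)) (Fin (n + 1)) ℂ) :
    ∃ (μ : ℂ) (v : Fin (n + 1) → ℂ), v ≠ 0 ∧ M *ᵥ v = μ • v := by
  obtain ⟨μ, hμ⟩ := Module.End.exists_eigenvalue (Matrix.toLin' M)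
  obtain ⟨v, hv⟩ := hμ.exists_hasEigenvector
  refine ⟨μ, v, hv.2, ?_⟩
  have h := Module.End.mem_eigenspace_iff.1 hv.1
  rwa [Matrix.toLin'_apply] at h

/-- Block matrix `1 ⊕ S` on `Fin (n+1)`. [folklore] -/
private def liftMat {n : ℕ} (S : Matrix (Fin n) (Fin n) ℂ) : Matrix (Fin (n + 1)) (Fin (n + 1)) ℂ :=
  Matrix.of fun i j => Fin.cases (Fin.cases (1 : ℂ) (fun _ => 0) j)
    (fun i' => Fin.cases (0 : ℂ) (fun j' => S i' j') j) i

/-- Entries of `1 ⊕ S`. [folklore] -/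
private theorem liftMat_zero_zero {n : ℕ} (S : Matrix (Fin n) (Fin n) ℂ) : liftMat S 0 0 = 1 := rfl
/-- Entries of `1 ⊕ S`. [folklore] -/
private theorem liftMat_zero_succ {n : ℕ} (S : Matrix (Fin n) (Fin n) ℂ) (j : Fin n) :
    liftMat S 0 j.succ = 0 := rfl
/-- Entries of `1 ⊕ S`. [folklore] -/
private theorem liftMat_succ_zero {n : ℕ} (S : Matrix (Fin n) (Fin n) ℂ) (i : Fin n) :
    liftMat S i.succ 0 = 0 := rfl
/-- Entries of `1 ⊕ S`. [folklore] -/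
private theorem liftMat_succ_succ {n : ℕ} (S : Matrix (Fin n) (Fin n) ℂ) (i j : Fin n) :
    liftMat S i.succ j.succ = S i j := rfl

/-- `(1 ⊕ S)(1 ⊕ S') = 1 ⊕ SS'`. [folklore] -/
private theorem liftMat_mul {n : ℕ} (S S' : Matrix (Fin n) (Fin n) ℂ) :
    liftMat S * liftMat S' = liftMat (S * S') := by
  ext i j
  rw [Matrix.mul_apply, Fin.sum_univ_succ]
  refine Fin.cases ?_ (fun i' => ?_) i <;> refine Fin.cases ?_ (fun j' => ?_) j
  · simp [liftMat_zero_zero, liftMat_zero_succ, liftMat_succ_zero]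
  · simp [liftMat_zero_zero, liftMat_zero_succ, liftMat_succ_succ]
  · simp [liftMat_zero_zero, liftMat_succ_zero, liftMat_succ_succ]
  · simp [liftMat_zero_succ, liftMat_succ_zero, liftMat_succ_succ, Matrix.mul_apply]

/-- `1 ⊕ 1 = 1`. [folklore] -/
private theorem liftMat_one {n : ℕ} : liftMat (1 : Matrix (Fin n) (Fin n) ℂ) = 1 := by
  ext i j
  refine Fin.cases ?_ (fun i' => ?_) i <;> refine Fin.cases ?_ (fun j' => ?_) j
  · simp [liftMat_zero_zero]
  · rw [liftMat_zero_succ, Matrix.one_apply_ne (Fin.succ_ne_zero j').symm]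
  · rw [liftMat_succ_zero, Matrix.one_apply_ne (Fin.succ_ne_zero i')]
  · simp [liftMat_succ_succ, Matrix.one_apply, Fin.succ_inj]

/-- Conjugating a matrix whose first column is `μ e₀` by `1 ⊕ S`: the lower-left block stays `0`
and the lower-right block is conjugated by `S`. [folklore] -/
private theorem liftMat_conj_apply {n : ℕ} (S S' : Matrix (Fin n) (Fin n) ℂ)
    (M₁ : Matrix (Fin (n + 1)) (Fin (n + 1)) ℂ) (hcol : ∀ i : Fin n, M₁ i.succ 0 = 0) (i : Fin n) :
    (liftMat S * M₁ * liftMat S') i.succ 0 = 0 ∧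
      ∀ j : Fin n, (liftMat S * M₁ * liftMat S') i.succ j.succ =
        (S * (Matrix.of fun a b : Fin n => M₁ a.succ b.succ) * S') i j := by
  have hrow : ∀ l : Fin (n + 1), (liftMat S * M₁) i.succ l = ∑ a : Fin n, S i a * M₁ a.succ l := by
    intro l
    rw [Matrix.mul_apply, Fin.sum_univ_succ, liftMat_succ_zero, zero_mul, zero_add]
    rfl
  constructor
  · rw [Matrix.mul_apply, Fin.sum_univ_succ, liftMat_zero_zero, mul_one]
    simp only [liftMat_succ_zero, mul_zero, Finset.sum_const_zero, add_zero]
    rw [hrow]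
    exact Finset.sum_eq_zero fun a _ => by rw [hcol a, mul_zero]
  · intro j
    rw [Matrix.mul_apply, Fin.sum_univ_succ, liftMat_zero_succ, mul_zero, zero_add]
    simp only [liftMat_succ_succ, hrow]
    rw [Matrix.mul_apply]
    refine Finset.sum_congr rfl fun b _ => ?_
    rw [Matrix.mul_apply]
    rfl

/-- **Triangularisation** (Schur): every `M ∈ Mat_n(ℂ)` is conjugate to an upper triangular
matrix: there are `S, S'` with `S S' = 1` and `(S M S')_{ij} = 0` for `j < i` (Schur's
theorem, here only similarity, not unitary similarity). Proof: an eigenvector (algebraic closure,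
`Module.End.exists_eigenvalue`), completed to a basis, and induction on `n`.
[cite: HornJohnson2013, Thm. 2.3.1] -/
theorem exists_conj_upperTriangular : ∀ (n : ℕ) (M : Matrix (Fin n) (Fin n) ℂ),
    ∃ S S' : Matrix (Fin n) (Fin n) ℂ, S * S' = 1 ∧ (S * M * S').BlockTriangular id
  | 0, M => ⟨1, 1, by simp, fun i => Fin.elim0 i⟩
  | n + 1, M => by
    classical
    obtain ⟨μ, v, hv0, hv⟩ := exists_eigenvector M
    -- an invertible `P` with first column `v`
    obtain ⟨Q, hQ, hQdet⟩ := exists_matrix_row_det_ne_zero (0 : Fin (n + 1)) v hv0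
    set P : Matrix (Fin (n + 1)) (Fin (n + 1)) ℂ := Qᵀ with hP
    have hPdet : IsUnit P.det := by
      rw [hP, Matrix.det_transpose]
      exact isUnit_iff_ne_zero.2 hQdet
    have hPcol : P *ᵥ Pi.single 0 1 = v := by
      rw [Matrix.mulVec_single_one]
      funext i
      simp [hP, ← hQ]
    set M₁ := P⁻¹ * M * P with hM₁
    have hM₁col : M₁ *ᵥ Pi.single 0 1 = μ • Pi.single 0 1 := by
      rw [hM₁, ← Matrix.mulVec_mulVec, ← Matrix.mulVec_mulVec, hPcol, hv, Matrix.mulVec_smul,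
        ← hPcol, Matrix.mulVec_mulVec, Matrix.nonsing_inv_mul P hPdet, Matrix.one_mulVec]
    have hcol : ∀ i : Fin n, M₁ i.succ 0 = 0 := by
      intro i
      have h := congrFun hM₁col i.succ
      rw [Matrix.mulVec_single_one] at h
      simpa [Fin.succ_ne_zero] using h
    -- induction on the lower-right block
    obtain ⟨S, S', hSS', htri⟩ :=
      exists_conj_upperTriangular n (Matrix.of fun a b : Fin n => M₁ a.succ b.succ)
    refine ⟨liftMat S * P⁻¹, P * liftMat S', ?_, ?_⟩
    · rw [Matrix.mul_assoc, ← Matrix.mul_assoc P⁻¹, Matrix.nonsing_inv_mul P hPdet, Matrix.one_mul,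
        liftMat_mul, hSS', liftMat_one]
    · have hconj : liftMat S * P⁻¹ * M * (P * liftMat S') = liftMat S * M₁ * liftMat S' := by
        rw [hM₁]
        simp only [Matrix.mul_assoc]
      rw [hconj]
      intro i j hij
      refine Fin.cases ?_ (fun i' => ?_) i hij
      · intro h; exact absurd h (Nat.not_lt_zero _)
      · intro h
        refine Fin.cases ?_ (fun j' => ?_) j h
        · intro _; exact (liftMat_conj_apply S S' M₁ hcol i').1
        · intro hj
          rw [(liftMat_conj_apply S S' M₁ hcol i').2 j']
          exact htri (Fin.succ_lt_succ_iff.1 hj)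

end Schur

/-! ## §8 The empty normal form: `G(T, 1, 1) = 0` for upper triangular `T` (obstruction designs only) -/

section Emptiness

variable {κ N m : ℕ} (e : Fin m × Fin m ≃ Fin N)
  (hN : ∀ x ∈ (bi2013Hook κ).youngDiagram.cells, x.1 < N) (hNeq : N = 2 * κ + 1)

/-- A non-vanishing column sign forces the labeling to be injective on the first column.
[cite: BurgisserIkenmeyer2013, §6.3 ("`J^(k)` is injective on hyperedges")] -/
theorem injOn_of_colSign_ne_zero (T : StdFilling (3 * κ + 1) (bi2013Hook κ).youngDiagram)
    {c : Fin (3 * κ + 1) → Fin N} (hc : colSign hN T hNeq c ≠ 0) {p q : Fin (3 * κ + 1)}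
    (hp : (T.1 p).2 = 0) (hq : (T.1 q).2 = 0) (hpq : c p = c q) : p = q := by
  classical
  by_contra hne
  apply hc
  have hρ : colEquiv hN T hNeq ⟨p, hp⟩ ≠ colEquiv hN T hNeq ⟨q, hq⟩ := fun h =>
    hne (congrArg Subtype.val ((colEquiv hN T hNeq).injective h))
  refine Matrix.det_zero_of_column_eq hρ fun i => ?_
  change (1 : Matrix (Fin N) (Fin N) ℂ) i
      (c ((colEquiv hN T hNeq).symm (colEquiv hN T hNeq ⟨p, hp⟩)).1) =
    (1 : Matrix (Fin N) (Fin N) ℂ) i (c ((colEquiv hN T hNeq).symm (colEquiv hN T hNeq ⟨q, hq⟩)).1)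
  rw [Equiv.symm_apply_apply, Equiv.symm_apply_apply]
  exact congrArg _ hpq

/-- … hence bijective onto the letters: every letter is the label of a first-column position
(BI 2013, §6.3: "Hence `J^(k)` is bijective on `e^(k)`"). [cite: BurgisserIkenmeyer2013, §6.3] -/
theorem bijective_of_colSign_ne_zero (T : StdFilling (3 * κ + 1) (bi2013Hook κ).youngDiagram)
    {c : Fin (3 * κ + 1) → Fin N} (hc : colSign hN T hNeq c ≠ 0) :
    Function.Bijective (fun q : {p : Fin (3 * κ + 1) // (T.1 p).2 = 0} => c q.1) := by
  rw [Fintype.bijective_iff_injective_and_card]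
  refine ⟨fun q q' h => Subtype.ext (injOn_of_colSign_ne_zero hN hNeq T hc q.2 q'.2 h), ?_⟩
  exact Fintype.card_congr (colEquiv hN T hNeq)

/-- Surjectivity form. [cite: BurgisserIkenmeyer2013, §6.3] -/
theorem exists_col_eq_of_colSign_ne_zero (T : StdFilling (3 * κ + 1) (bi2013Hook κ).youngDiagram)
    {c : Fin (3 * κ + 1) → Fin N} (hc : colSign hN T hNeq c ≠ 0) (y : Fin N) :
    ∃ p : Fin (3 * κ + 1), (T.1 p).2 = 0 ∧ c p = y := by
  obtain ⟨⟨p, hp⟩, h⟩ := (bijective_of_colSign_ne_zero hN hNeq T hc).2 y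
  exact ⟨p, hp, h⟩

/-- The sum of any function of the letters over the first column equals its sum over all letters.
[cite: BurgisserIkenmeyer2013, §6.3] -/
theorem sum_col_eq_sum_univ (T : StdFilling (3 * κ + 1) (bi2013Hook κ).youngDiagram)
    {c : Fin (3 * κ + 1) → Fin N} (hc : colSign hN T hNeq c ≠ 0) (φ : Fin N → ℤ) :
    ∑ p ∈ Finset.univ.filter (fun p => (T.1 p).2 = 0), φ (c p) = ∑ y, φ y := by
  classical
  rw [Finset.sum_subtype (Finset.univ.filter (fun p => (T.1 p).2 = 0)) (p := fun p => (T.1 p).2 = 0)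
    (fun p => by simp)]
  exact Fintype.sum_bijective _ (bijective_of_colSign_ne_zero hN hNeq T hc) _ _ fun q => rfl

/-- The "imbalance" `(j − i)` of a pair sums to zero over all pairs. [folklore] -/
private theorem sum_sub_eq_zero (m : ℕ) : ∑ q : Fin m × Fin m, ((q.2 : ℤ) - q.1) = 0 := by
  have h : ∑ q : Fin m × Fin m, ((q.2 : ℤ) - q.1) = ∑ q : Fin m × Fin m, ((q.1 : ℤ) - q.2) :=
    (Equiv.sum_comp (Equiv.prodComm (Fin m) (Fin m)) (fun q => ((q.2 : ℤ) - q.1))).symm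
  have h2 : ∑ q : Fin m × Fin m, ((q.1 : ℤ) - q.2) = -∑ q : Fin m × Fin m, ((q.2 : ℤ) - q.1) := by
    rw [← Finset.sum_neg_distrib]
    exact Finset.sum_congr rfl fun q _ => by ring
  omega

variable (T₁ T₂ T₃ : StdFilling (3 * κ + 1) (bi2013Hook κ).youngDiagram)

/-- **The empty normal form** (refute-g25 README, step 5): if the three hook tableaux form an
obstruction design (no two positions in a common column of all three), `m ≥ 3`, and `T` is
upper triangular, then EVERY term of `G(T, 1, 1)` vanishes, so `G(T, 1, 1) = 0`.
The telescoping identity `∑_{arm₁}(ν−k) + ∑_{arm₂}(k−μ) + ∑_{arm₃}(μ−ν) = 0` (from the three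
bijections on the first columns) forces all arm labels to be diagonal; then the diagonal letters
`(i,i)` with `i` different from the first two coordinates of the label of the centre position
cannot be placed. [cite: BurgisserIkenmeyer2013, §6.3–6.4 (the analysis this replaces)] -/
theorem armG_upperTriangular_eq_zero (hm : 3 ≤ m)
    (hdesign : ∀ p q : Fin (3 * κ + 1), p ≠ q →
      (T₁.1 p).2 ≠ (T₁.1 q).2 ∨ (T₂.1 p).2 ≠ (T₂.1 q).2 ∨ (T₃.1 p).2 ≠ (T₃.1 q).2)
    (X : Matrix (Fin m) (Fin m) ℂ) (hX : X.BlockTriangular id) :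
    armG e hN hNeq T₁ T₂ T₃ (vecOf e X) (vecOf e 1) (vecOf e 1) = 0 := by
  classical
  -- the arms are pairwise disjoint (`snd_eq_zero_of_snd_ne_zero`)
  have h21 : ∀ x, (T₁.1 x).2 ≠ 0 → (T₂.1 x).2 = 0 := fun x hx =>
    snd_eq_zero_of_snd_ne_zero T₂ T₁ T₃ (fun p q hpq h2 h1 => by
      rcases hdesign p q hpq with h | h | h
      · exact absurd h1 h
      · exact absurd h2 h
      · exact h) hx
  have h31 : ∀ x, (T₁.1 x).2 ≠ 0 → (T₃.1 x).2 = 0 := fun x hx =>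
    snd_eq_zero_of_snd_ne_zero T₃ T₁ T₂ (fun p q hpq h3 h1 => by
      rcases hdesign p q hpq with h | h | h
      · exact absurd h1 h
      · exact h
      · exact absurd h3 h) hx
  have h32 : ∀ x, (T₂.1 x).2 ≠ 0 → (T₃.1 x).2 = 0 := fun x hx =>
    snd_eq_zero_of_snd_ne_zero T₃ T₂ T₁ (fun p q hpq h3 h2 => by
      rcases hdesign p q hpq with h | h | h
      · exact h
      · exact absurd h2 h
      · exact absurd h3 h) hx
  have h12 : ∀ x, (T₂.1 x).2 ≠ 0 → (T₁.1 x).2 = 0 := fun x hx =>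
    snd_eq_zero_of_snd_ne_zero T₁ T₂ T₃ (fun p q hpq h1 h2 => by
      rcases hdesign p q hpq with h | h | h
      · exact absurd h1 h
      · exact absurd h2 h
      · exact h) hx
  have h13 : ∀ x, (T₃.1 x).2 ≠ 0 → (T₁.1 x).2 = 0 := fun x hx =>
    snd_eq_zero_of_snd_ne_zero T₁ T₃ T₂ (fun p q hpq h1 h3 => by
      rcases hdesign p q hpq with h | h | h
      · exact absurd h1 h
      · exact h
      · exact absurd h3 h) hx
  have h23 : ∀ x, (T₃.1 x).2 ≠ 0 → (T₂.1 x).2 = 0 := fun x hx =>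
    snd_eq_zero_of_snd_ne_zero T₂ T₃ T₁ (fun p q hpq h2 h3 => by
      rcases hdesign p q hpq with h | h | h
      · exact h
      · exact absurd h2 h
      · exact absurd h3 h) hx
  refine Finset.sum_eq_zero fun J _ => ?_
  by_contra hJ
  -- all factors are nonzero
  have hs₁ : colSign hN T₁ hNeq (fun p => e (lab₁ (J p))) ≠ 0 := fun h => hJ (by rw [h]; ring)
  have hs₂ : colSign hN T₂ hNeq (fun p => e (lab₂ (J p))) ≠ 0 := fun h => hJ (by rw [h]; ring)
  have hs₃ : colSign hN T₃ hNeq (fun p => e (lab₃ (J p))) ≠ 0 := fun h => hJ (by rw [h]; ring)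
  have hπ₁ : ∏ p ∈ arm T₁, vecOf e X (e (lab₁ (J p))) ≠ 0 := fun h => hJ (by rw [h]; ring)
  have hπ₂ : ∏ p ∈ arm T₂, vecOf e (1 : Matrix (Fin m) (Fin m) ℂ) (e (lab₂ (J p))) ≠ 0 :=
    fun h => hJ (by rw [h]; ring)
  have hπ₃ : ∏ p ∈ arm T₃, vecOf e (1 : Matrix (Fin m) (Fin m) ℂ) (e (lab₃ (J p))) ≠ 0 :=
    fun h => hJ (by rw [h]; ring)
  -- arm constraints
  have hA₁ : ∀ p, (T₁.1 p).2 ≠ 0 → (J p).1 ≤ (J p).2.2 := by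
    intro p hp
    by_contra hlt
    push Not at hlt
    apply hπ₁
    refine Finset.prod_eq_zero (i := p) (by simp [hp]) ?_
    simp only [vecOf, Equiv.symm_apply_apply, lab₁]
    exact hX hlt
  have hA₂ : ∀ p, (T₂.1 p).2 ≠ 0 → (J p).1 = (J p).2.1 := by
    intro p hp
    by_contra hne
    apply hπ₂
    refine Finset.prod_eq_zero (i := p) (by simp [hp]) ?_
    simp [vecOf, lab₂, hne]
  have hA₃ : ∀ p, (T₃.1 p).2 ≠ 0 → (J p).2.1 = (J p).2.2 := by
    intro p hp
    by_contra hne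
    apply hπ₃
    refine Finset.prod_eq_zero (i := p) (by simp [hp]) ?_
    simp [vecOf, lab₃, hne]
  -- telescoping: the arm labels of `T₁` are diagonal too
  set φ : Fin m × Fin m → ℤ := fun q => (q.2 : ℤ) - q.1 with hφ
  have hcol₁ : ∑ p ∈ Finset.univ.filter (fun p => (T₁.1 p).2 = 0), φ (lab₁ (J p)) = 0 := by
    have := sum_col_eq_sum_univ hN hNeq T₁ hs₁ (fun y => φ (e.symm y))
    simp only [Equiv.symm_apply_apply] at this
    rw [this, Equiv.sum_comp e.symm φ, hφ]
    exact sum_sub_eq_zero m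
  have hcol₂ : ∑ p ∈ Finset.univ.filter (fun p => (T₂.1 p).2 = 0), φ (lab₂ (J p)) = 0 := by
    have := sum_col_eq_sum_univ hN hNeq T₂ hs₂ (fun y => φ (e.symm y))
    simp only [Equiv.symm_apply_apply] at this
    rw [this, Equiv.sum_comp e.symm φ, hφ]
    exact sum_sub_eq_zero m
  have hcol₃ : ∑ p ∈ Finset.univ.filter (fun p => (T₃.1 p).2 = 0), φ (lab₃ (J p)) = 0 := by
    have := sum_col_eq_sum_univ hN hNeq T₃ hs₃ (fun y => φ (e.symm y))
    simp only [Equiv.symm_apply_apply] at this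
    rw [this, Equiv.sum_comp e.symm φ, hφ]
    exact sum_sub_eq_zero m
  have htot : ∑ p : Fin (3 * κ + 1), (φ (lab₁ (J p)) - φ (lab₂ (J p)) - φ (lab₃ (J p))) = 0 :=
    Finset.sum_eq_zero fun p _ => by simp only [hφ, lab₁, lab₂, lab₃]; ring
  have hsplit : ∀ (T : StdFilling (3 * κ + 1) (bi2013Hook κ).youngDiagram) (f : Fin (3 * κ + 1) → ℤ),
      ∑ p, f p = (∑ p ∈ Finset.univ.filter (fun p => (T.1 p).2 = 0), f p) + ∑ p ∈ arm T, f p := by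
    intro T f
    rw [arm, Finset.sum_filter_add_sum_filter_not]
  have harm : ∑ p ∈ arm T₁, φ (lab₁ (J p)) - ∑ p ∈ arm T₂, φ (lab₂ (J p)) -
      ∑ p ∈ arm T₃, φ (lab₃ (J p)) = 0 := by
    have h := htot
    rw [Finset.sum_sub_distrib, Finset.sum_sub_distrib, hsplit T₁, hsplit T₂ (fun p => φ (lab₂ (J p))),
      hsplit T₃ (fun p => φ (lab₃ (J p))), hcol₁, hcol₂, hcol₃] at h
    linarith
  have harm₂ : ∑ p ∈ arm T₂, φ (lab₂ (J p)) = 0 :=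
    Finset.sum_eq_zero fun p hp => by
      simp only [arm, Finset.mem_filter, Finset.mem_univ, true_and] at hp
      simp only [hφ, lab₂, hA₂ p hp, sub_self]
  have harm₃ : ∑ p ∈ arm T₃, φ (lab₃ (J p)) = 0 :=
    Finset.sum_eq_zero fun p hp => by
      simp only [arm, Finset.mem_filter, Finset.mem_univ, true_and] at hp
      simp only [hφ, lab₃, hA₃ p hp, sub_self]
  rw [harm₂, harm₃, sub_zero, sub_zero] at harm
  have hA₁' : ∀ p, (T₁.1 p).2 ≠ 0 → (J p).1 = (J p).2.2 := by
    have hnn : ∀ p ∈ arm T₁, 0 ≤ φ (lab₁ (J p)) := fun p hp => by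
      simp only [arm, Finset.mem_filter, Finset.mem_univ, true_and] at hp
      have := hA₁ p hp
      simp only [hφ, lab₁, sub_nonneg]
      exact_mod_cast this
    intro p hp
    have h0 := (Finset.sum_eq_zero_iff_of_nonneg hnn).1 harm p (by simp [hp])
    simp only [hφ, lab₁, sub_eq_zero] at h0
    exact (Fin.ext (by exact_mod_cast h0.symm))
  -- the centre positions (in no arm): at most one
  set Z : Finset (Fin (3 * κ + 1)) := Finset.univ.filter
    (fun p => (T₁.1 p).2 = 0 ∧ (T₂.1 p).2 = 0 ∧ (T₃.1 p).2 = 0) with hZ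
  have hZcard : Z.card ≤ 1 := by
    have hsub : Z ∪ (arm T₂ ∪ arm T₃) ⊆ Finset.univ.filter (fun p => (T₁.1 p).2 = 0) := by
      intro p hp
      simp only [hZ, arm, Finset.mem_union, Finset.mem_filter, Finset.mem_univ, true_and] at hp
      simp only [Finset.mem_filter, Finset.mem_univ, true_and]
      rcases hp with hp | hp | hp
      · exact hp.1
      · exact h12 p hp
      · exact h13 p hp
    have hdis₁ : Disjoint Z (arm T₂ ∪ arm T₃) := by
      rw [Finset.disjoint_left]
      intro p hp hp'
      simp only [hZ, arm, Finset.mem_union, Finset.mem_filter, Finset.mem_univ, true_and] at hp hp'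
      rcases hp' with h | h
      · exact h hp.2.1
      · exact h hp.2.2
    have hdis₂ : Disjoint (arm T₂) (arm T₃) := by
      rw [Finset.disjoint_left]
      intro p hp hp'
      simp only [arm, Finset.mem_filter, Finset.mem_univ, true_and] at hp hp'
      exact hp' (h32 p hp)
    have hcard := Finset.card_le_card hsub
    rw [Finset.card_union_of_disjoint hdis₁, Finset.card_union_of_disjoint hdis₂,
      card_arm hN hNeq T₂, card_arm hN hNeq T₃] at hcard
    have hcol : (Finset.univ.filter fun p : Fin (3 * κ + 1) => (T₁.1 p).2 = 0).card = 2 * κ + 1 := by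
      rw [← hNeq, ← Fintype.card_fin N, ← Fintype.card_congr (colEquiv hN T₁ hNeq),
        Fintype.card_subtype]
    omega
  -- choose a diagonal letter `i` avoiding the first two coordinates of the centre label(s)
  set B : Finset (Fin m) := Z.image (fun p => (J p).1) ∪ Z.image (fun p => (J p).2.1) with hB
  have hBcard : B.card < m := by
    calc B.card ≤ (Z.image (fun p => (J p).1)).card + (Z.image (fun p => (J p).2.1)).card :=
          Finset.card_union_le _ _
      _ ≤ Z.card + Z.card := add_le_add Finset.card_image_le Finset.card_image_le
      _ < m := by omega
  obtain ⟨i, hi⟩ : ∃ i : Fin m, i ∉ B := by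
    by_contra h
    push Not at h
    have : (Finset.univ : Finset (Fin m)) ⊆ B := fun i _ => h i
    have := Finset.card_le_card this
    rw [Finset.card_univ, Fintype.card_fin] at this
    omega
  have hiZ₁ : ∀ p ∈ Z, (J p).1 ≠ i := by
    intro p hp h
    exact hi (Finset.mem_union.2 (Or.inl (Finset.mem_image.2 ⟨p, hp, h⟩)))
  have hiZ₂ : ∀ p ∈ Z, (J p).2.1 ≠ i := by
    intro p hp h
    exact hi (Finset.mem_union.2 (Or.inr (Finset.mem_image.2 ⟨p, hp, h⟩)))
  have memZ : ∀ p, (T₁.1 p).2 = 0 → (T₂.1 p).2 = 0 → (T₃.1 p).2 = 0 → p ∈ Z := fun p h1 h2 h3 => by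
    simp [hZ, h1, h2, h3]
  -- injectivity on columns, in usable form
  have inj₁ := fun {p q : Fin (3 * κ + 1)} (hp : (T₁.1 p).2 = 0) (hq : (T₁.1 q).2 = 0)
    (h : lab₁ (J p) = lab₁ (J q)) =>
    injOn_of_colSign_ne_zero hN hNeq T₁ hs₁ hp hq (by simp only [h])
  have inj₂ := fun {p q : Fin (3 * κ + 1)} (hp : (T₂.1 p).2 = 0) (hq : (T₂.1 q).2 = 0)
    (h : lab₂ (J p) = lab₂ (J q)) =>
    injOn_of_colSign_ne_zero hN hNeq T₂ hs₂ hp hq (by simp only [h])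
  have inj₃ := fun {p q : Fin (3 * κ + 1)} (hp : (T₃.1 p).2 = 0) (hq : (T₃.1 q).2 = 0)
    (h : lab₃ (J p) = lab₃ (J q)) =>
    injOn_of_colSign_ne_zero hN hNeq T₃ hs₃ hp hq (by simp only [h])
  -- the letter `(i,i)` of layer 1 sits at some first-column position `p` of `T₁`
  obtain ⟨p, hp₁, hp⟩ := exists_col_eq_of_colSign_ne_zero hN hNeq T₁ hs₁ (e (i, i))
  have hp' : lab₁ (J p) = (i, i) := e.injective hp
  simp only [lab₁, Prod.mk.injEq] at hp'
  -- `p` is not a centre position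
  by_cases hp₂ : (T₂.1 p).2 = 0
  · by_cases hp₃ : (T₃.1 p).2 = 0
    · exact hiZ₁ p (memZ p hp₁ hp₂ hp₃) hp'.1
    · -- `p ∈ arm₃`: `J p = (i,i,i)`; look at the letter `(i,i)` of layer 3
      have hJp : (J p).2.1 = i := by rw [hA₃ p hp₃, hp'.2]
      obtain ⟨p', hp'₃, hq⟩ := exists_col_eq_of_colSign_ne_zero hN hNeq T₃ hs₃ (e (i, i))
      have hq' : lab₃ (J p') = (i, i) := e.injective hq
      simp only [lab₃, Prod.mk.injEq] at hq'
      by_cases hp'₁ : (T₁.1 p').2 = 0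
      · by_cases hp'₂ : (T₂.1 p').2 = 0
        · exact hiZ₂ p' (memZ p' hp'₁ hp'₂ hp'₃) hq'.1
        · -- `p' ∈ arm₂`: `J p' = (i,i,i)`, clash with `p` in layer 1
          have h1 : (J p').1 = i := by rw [hA₂ p' hp'₂, hq'.1]
          have hpp' : p = p' := inj₁ hp₁ hp'₁ (by
            simp only [lab₁, Prod.mk.injEq]; exact ⟨hp'.1.trans h1.symm, hp'.2.trans hq'.2.symm⟩)
          exact hp₃ (by rw [hpp']; exact hp'₃)
      · -- `p' ∈ arm₁`: `J p' = (i,i,i)`, clash with `p` in layer 2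
        have h1 : (J p').1 = i := by rw [hA₁' p' hp'₁, hq'.2]
        have hpp' : p = p' := inj₂ hp₂ (h21 p' hp'₁) (by
          simp only [lab₂, Prod.mk.injEq]; exact ⟨hp'.1.trans h1.symm, hJp.trans hq'.1.symm⟩)
        exact hp'₁ (by rw [← hpp']; exact hp₁)
  · -- `p ∈ arm₂`: `J p = (i,i,i)`; look at the letter `(i,i)` of layer 2
    have hJp : (J p).2.1 = i := by rw [← hA₂ p hp₂, hp'.1]
    obtain ⟨p', hp'₂, hq⟩ := exists_col_eq_of_colSign_ne_zero hN hNeq T₂ hs₂ (e (i, i))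
    have hq' : lab₂ (J p') = (i, i) := e.injective hq
    simp only [lab₂, Prod.mk.injEq] at hq'
    by_cases hp'₁ : (T₁.1 p').2 = 0
    · by_cases hp'₃ : (T₃.1 p').2 = 0
      · exact hiZ₁ p' (memZ p' hp'₁ hp'₂ hp'₃) hq'.1
      · -- `p' ∈ arm₃`: clash with `p` in layer 1
        have h3 : (J p').2.2 = i := by rw [← hA₃ p' hp'₃, hq'.2]
        have hpp' : p = p' := inj₁ hp₁ hp'₁ (by
          simp only [lab₁, Prod.mk.injEq]; exact ⟨hp'.1.trans hq'.1.symm, hp'.2.trans h3.symm⟩)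
        exact hp₂ (by rw [hpp']; exact hp'₂)
    · -- `p' ∈ arm₁`: clash with `p` in layer 3
      have h3 : (J p').2.2 = i := by rw [← hA₁' p' hp'₁, hq'.1]
      have hpp' : p = p' := inj₃ (h32 p hp₂) (h31 p' hp'₁) (by
        simp only [lab₃, Prod.mk.injEq]; exact ⟨hJp.trans hq'.2.symm, hp'.2.trans h3.symm⟩)
      exact hp'₁ (by rw [← hpp']; exact hp₁)

end Emptiness

/-! ## §9 Density in the singular directions, and the assembly -/

section Assembly

/-- A polynomial in the entries of an `m × m` matrix that vanishes at every matrix with nonzero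
determinant is zero (multiply by the generic determinant and use `MvPolynomial.funext`).
[folklore] -/
private theorem mvPolynomial_eq_zero_of_eval_eq_zero_of_det_ne_zero {m : ℕ}
    (P : MvPolynomial (Fin m × Fin m) ℂ)
    (h : ∀ Y : Matrix (Fin m) (Fin m) ℂ, Y.det ≠ 0 → MvPolynomial.eval (fun ij => Y ij.1 ij.2) P = 0) :
    P = 0 := by
  classical
  have hPD : P * (Matrix.mvPolynomialX (Fin m) (Fin m) ℂ).det = 0 := by
    apply MvPolynomial.funext
    intro x
    rw [map_mul, map_zero, Matrix.eval_det_mvPolynomialX]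
    by_cases hx : (Matrix.of fun i j : Fin m => x (i, j)).det = 0
    · rw [hx, mul_zero]
    · have := h (Matrix.of fun i j : Fin m => x (i, j)) hx
      have hfun : (fun ij : Fin m × Fin m => (Matrix.of fun i j : Fin m => x (i, j)) ij.1 ij.2) = x := by
        funext ij; simp
      rw [hfun] at this
      rw [this, zero_mul]
  rcases mul_eq_zero.1 hPD with hP | hD
  · exact hP
  · exact absurd hD (Matrix.det_mvPolynomialX_ne_zero (Fin m) ℂ)

variable {κ N m : ℕ} (e : Fin m × Fin m ≃ Fin N)
  (hN : ∀ x ∈ (bi2013Hook κ).youngDiagram.cells, x.1 < N) (hNeq : N = 2 * κ + 1)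
  (T₁ T₂ T₃ : StdFilling (3 * κ + 1) (bi2013Hook κ).youngDiagram)

/-- Entries of `vecOf`. [folklore] -/
private theorem vecOf_apply_e (X : Matrix (Fin m) (Fin m) ℂ) (q : Fin m × Fin m) :
    vecOf e X (e q) = X q.1 q.2 := by
  simp [vecOf]

/-- `G(X, Y, Z)` is a polynomial in the entries of `Y`. [folklore] -/
private theorem armG_eq_eval_Y (X Y Z : Matrix (Fin m) (Fin m) ℂ) :
    armG e hN hNeq T₁ T₂ T₃ (vecOf e X) (vecOf e Y) (vecOf e Z) =
      MvPolynomial.eval (fun ij => Y ij.1 ij.2)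
        (∑ J : Fin (3 * κ + 1) → Fin m × Fin m × Fin m,
          MvPolynomial.C (colSign hN T₁ hNeq (fun p => e (lab₁ (J p))) *
              colSign hN T₂ hNeq (fun p => e (lab₂ (J p))) *
              colSign hN T₃ hNeq (fun p => e (lab₃ (J p)))) *
            (MvPolynomial.C (∏ p ∈ arm T₁, vecOf e X (e (lab₁ (J p)))) *
              (∏ p ∈ arm T₂, MvPolynomial.X (lab₂ (J p))) *
              MvPolynomial.C (∏ p ∈ arm T₃, vecOf e Z (e (lab₃ (J p)))))) := by
  rw [armG, map_sum]
  refine Finset.sum_congr rfl fun J _ => ?_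
  simp only [map_mul, MvPolynomial.eval_C, map_prod, MvPolynomial.eval_X, vecOf_apply_e]

/-- `G(X, Y, Z)` is a polynomial in the entries of `Z`. [folklore] -/
private theorem armG_eq_eval_Z (X Y Z : Matrix (Fin m) (Fin m) ℂ) :
    armG e hN hNeq T₁ T₂ T₃ (vecOf e X) (vecOf e Y) (vecOf e Z) =
      MvPolynomial.eval (fun ij => Z ij.1 ij.2)
        (∑ J : Fin (3 * κ + 1) → Fin m × Fin m × Fin m,
          MvPolynomial.C (colSign hN T₁ hNeq (fun p => e (lab₁ (J p))) *
              colSign hN T₂ hNeq (fun p => e (lab₂ (J p))) *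
              colSign hN T₃ hNeq (fun p => e (lab₃ (J p)))) *
            (MvPolynomial.C (∏ p ∈ arm T₁, vecOf e X (e (lab₁ (J p)))) *
              MvPolynomial.C (∏ p ∈ arm T₂, vecOf e Y (e (lab₂ (J p)))) *
              (∏ p ∈ arm T₃, MvPolynomial.X (lab₃ (J p))))) := by
  rw [armG, map_sum]
  refine Finset.sum_congr rfl fun J _ => ?_
  simp only [map_mul, MvPolynomial.eval_C, map_prod, MvPolynomial.eval_X, vecOf_apply_e]

/-- **`G ≡ 0` for obstruction designs** (refute-g25 README, steps 3–6 assembled): normal form,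
triangularisation, emptiness, and density in the singular `Y`, `Z`.
[cite: BurgisserIkenmeyer2013, Lemma 4.4 (refuted)] -/
theorem armG_eq_zero_of_design (hm : 3 ≤ m) (hκ : 1 ≤ κ)
    (hdesign : ∀ p q : Fin (3 * κ + 1), p ≠ q →
      (T₁.1 p).2 ≠ (T₁.1 q).2 ∨ (T₂.1 p).2 ≠ (T₂.1 q).2 ∨ (T₃.1 p).2 ≠ (T₃.1 q).2)
    (x y z : Fin N → ℂ) : armG e hN hNeq T₁ T₂ T₃ x y z = 0 := by
  classical
  -- (a) `G(M, 1, 1) = 0` for every `M`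
  have hM : ∀ M : Matrix (Fin m) (Fin m) ℂ,
      armG e hN hNeq T₁ T₂ T₃ (vecOf e M) (vecOf e 1) (vecOf e 1) = 0 := by
    intro M
    obtain ⟨S, S', hSS', htri⟩ := exists_conj_upperTriangular m M
    have hS : IsUnit S.det := Matrix.isUnit_det_of_right_inverse hSS'
    rw [armG_conj e hN hNeq T₁ T₂ T₃ hκ M S hS, Matrix.inv_eq_right_inv hSS']
    exact armG_upperTriangular_eq_zero e hN hNeq T₁ T₂ T₃ hm hdesign _ htri
  -- (b) invertible `Y, Z`
  have hinv : ∀ X Y Z : Matrix (Fin m) (Fin m) ℂ, Y.det ≠ 0 → Z.det ≠ 0 →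
      armG e hN hNeq T₁ T₂ T₃ (vecOf e X) (vecOf e Y) (vecOf e Z) = 0 := by
    intro X Y Z hY hZ
    rw [armG_eq_armG_mul_one_one e hN hNeq T₁ T₂ T₃ hκ X Y Z (isUnit_iff_ne_zero.2 hY)
      (isUnit_iff_ne_zero.2 hZ)]
    exact hM _
  -- (c) all `Y`, invertible `Z`
  have hY : ∀ X Y Z : Matrix (Fin m) (Fin m) ℂ, Z.det ≠ 0 →
      armG e hN hNeq T₁ T₂ T₃ (vecOf e X) (vecOf e Y) (vecOf e Z) = 0 := by
    intro X Y Z hZ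
    have hP := mvPolynomial_eq_zero_of_eval_eq_zero_of_det_ne_zero _ (fun Y' hY' => by
      rw [← armG_eq_eval_Y e hN hNeq T₁ T₂ T₃ X Y' Z]
      exact hinv X Y' Z hY' hZ)
    rw [armG_eq_eval_Y e hN hNeq T₁ T₂ T₃ X Y Z, hP, map_zero]
  -- (d) all `Y, Z`
  have hall : ∀ X Y Z : Matrix (Fin m) (Fin m) ℂ,
      armG e hN hNeq T₁ T₂ T₃ (vecOf e X) (vecOf e Y) (vecOf e Z) = 0 := by
    intro X Y Z
    have hP := mvPolynomial_eq_zero_of_eval_eq_zero_of_det_ne_zero _ (fun Z' hZ' => by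
      rw [← armG_eq_eval_Z e hN hNeq T₁ T₂ T₃ X Y Z']
      exact hY X Y Z' hZ')
    rw [armG_eq_eval_Z e hN hNeq T₁ T₂ T₃ X Y Z, hP, map_zero]
  rw [← vecOf_matOf e x, ← vecOf_matOf e y, ← vecOf_matOf e z]
  exact hall _ _ _

include hNeq in
/-- **All elementary pairings vanish**: for every three standard tableaux of hook shape
`(κ+1, 1^{2κ})`, `2κ + 1 = N`, `m ≥ 3`, and all `A, B, C ∈ Mat_N(ℂ)`,
`∑_J ⟨⊗ a_{lab₁J}, e_{T₁}⟩ ⟨⊗ b_{lab₂J}, e_{T₂}⟩ ⟨⊗ c_{lab₃J}, e_{T₃}⟩ = 0`. Non-designs by §2,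
designs by the factorisation and `G ≡ 0`. [cite: BurgisserIkenmeyer2013, Lemma 4.4 (refuted)] -/
theorem hook_tripleSumJ_eq_zero (hm : 3 ≤ m) (hκ : 1 ≤ κ) (A B C : Matrix (Fin N) (Fin N) ℂ) :
    ∑ J : Fin (3 * κ + 1) → Fin m × Fin m × Fin m,
        (∑ u : Word N (3 * κ + 1), (∏ r, A (u r) (e (lab₁ (J r)))) * T₁.polytabloid ℂ hN u) *
        (∑ v : Word N (3 * κ + 1), (∏ r, B (v r) (e (lab₂ (J r)))) * T₂.polytabloid ℂ hN v) *
        (∑ w : Word N (3 * κ + 1), (∏ r, C (w r) (e (lab₃ (J r)))) * T₃.polytabloid ℂ hN w) = 0 := by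
  by_cases h : ∀ p q : Fin (3 * κ + 1), p ≠ q →
      (T₁.1 p).2 ≠ (T₁.1 q).2 ∨ (T₂.1 p).2 ≠ (T₂.1 q).2 ∨ (T₃.1 p).2 ≠ (T₃.1 q).2
  · rw [tripleSumJ_eq_det_mul_armG e hN hNeq T₁ T₂ T₃,
      armG_eq_zero_of_design e hN hNeq T₁ T₂ T₃ hm hκ h, mul_zero]
  · push Not at h
    obtain ⟨p, q, hpq, h₁, h₂, h₃⟩ := h
    exact tripleSumJ_eq_zero_of_common_column e hN hN hN T₁ T₂ T₃ hpq h₁ h₂ h₃ A B C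

include hNeq in
/-- **All pairings of `((A⊗B⊗C)·⟨m,m,m⟩)^{⊗(3κ+1)}` with highest-weight vectors of weight `λ(κ)`
vanish** (`2κ + 1 = N = m²`, `m ≥ 3`): the highest-weight vectors are combinations of
polytabloids (tree `exists_sum_smul_polytabloid_eq`, BI 2013 Thm. 4.1 one factor at a time).
[cite: BurgisserIkenmeyer2013, Lemma 4.4 (refuted), with Thm. 4.1] -/
theorem pairing_matMulRelabel_hook_eq_zero (hm : 3 ≤ m) (hκ : 1 ≤ κ)
    (A B C : Matrix (Fin N) (Fin N) ℂ)
    (a₁ a₂ a₃ : StdFilling (3 * κ + 1) (bi2013Hook κ).youngDiagram → ℂ) :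
    ∑ u, ∑ v, ∑ w, kroneckerPow (actTensor A B C (matMulRelabel m N e)) (3 * κ + 1) u v w *
      triad (∑ T, a₁ T • T.polytabloid ℂ hN) (∑ T, a₂ T • T.polytabloid ℂ hN)
        (∑ T, a₃ T • T.polytabloid ℂ hN) u v w = 0 := by
  rw [pairing_matMulRelabel_eq_sum]
  simp only [sum_prod_mul_sum_smul_polytabloid]
  set P₁ : (Fin (3 * κ + 1) → Fin m × Fin m × Fin m) →
      StdFilling (3 * κ + 1) (bi2013Hook κ).youngDiagram → ℂ :=
    fun J T => ∑ u : Word N (3 * κ + 1), (∏ r, A (u r) (e (lab₁ (J r)))) * T.polytabloid ℂ hN u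
    with hP₁
  set P₂ : (Fin (3 * κ + 1) → Fin m × Fin m × Fin m) →
      StdFilling (3 * κ + 1) (bi2013Hook κ).youngDiagram → ℂ :=
    fun J T => ∑ v : Word N (3 * κ + 1), (∏ r, B (v r) (e (lab₂ (J r)))) * T.polytabloid ℂ hN v
    with hP₂
  set P₃ : (Fin (3 * κ + 1) → Fin m × Fin m × Fin m) →
      StdFilling (3 * κ + 1) (bi2013Hook κ).youngDiagram → ℂ :=
    fun J T => ∑ w : Word N (3 * κ + 1), (∏ r, C (w r) (e (lab₃ (J r)))) * T.polytabloid ℂ hN w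
    with hP₃
  have hexp : ∀ J : Fin (3 * κ + 1) → Fin m × Fin m × Fin m,
      (∑ T, a₁ T * P₁ J T) * (∑ T, a₂ T * P₂ J T) * (∑ T, a₃ T * P₃ J T) =
        ∑ S₁, ∑ S₂, ∑ S₃, (a₁ S₁ * a₂ S₂ * a₃ S₃) * (P₁ J S₁ * P₂ J S₂ * P₃ J S₃) := by
    intro J
    rw [Finset.sum_mul_sum, Finset.sum_mul]
    refine Finset.sum_congr rfl fun S₁ _ => ?_
    rw [Finset.sum_mul]
    refine Finset.sum_congr rfl fun S₂ _ => ?_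
    rw [Finset.mul_sum]
    refine Finset.sum_congr rfl fun S₃ _ => ?_
    ring
  change ∑ J, (∑ T, a₁ T * P₁ J T) * (∑ T, a₂ T * P₂ J T) * (∑ T, a₃ T * P₃ J T) = 0
  rw [Finset.sum_congr rfl fun J _ => hexp J, sum_comm₄']
  refine Finset.sum_eq_zero fun S₁ _ => Finset.sum_eq_zero fun S₂ _ =>
    Finset.sum_eq_zero fun S₃ _ => ?_
  rw [← Finset.mul_sum, hP₁, hP₂, hP₃, hook_tripleSumJ_eq_zero e hN hNeq S₁ S₂ S₃ hm hκ A B C,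
    mul_zero]

/-- **Bürgisser–Ikenmeyer 2013, Lemma 4.4 / Rem. 4.7 (matrix-multiplication half) REFUTED.**
For every `m ≥ 3` and `κ` with `2κ + 1 = m²` (in print: `m` odd, `κ = (m²−1)/2`), the type
`λ(κ) = (hook, hook, hook)`, `hook = (κ+1, 1^{2κ})`, does NOT occur in degree `3κ + 1` of the
coordinate ring of the orbit closure of the matrix multiplication tensor `⟨m,m,m⟩`: the triple
isotypic character sum of type `λ(κ)` kills `⟨m,m,m⟩^{⊗(3κ+1)}`. In print: Lemma 4.4 asserts
"There exists a matrix triple `A ∈ (GL_{m²})³` such that `f_{H_κ}(A MaMu_m) ≠ 0`", and Rem. 4.7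
concludes "Hence `λ(κ)` is an occurence obstruction against `MaMu_m ∈ closure(GL_n³ E_n)`" — both
fail; the printed proof breaks at §6.4, Claim 24 (the valid sets carry alternating signs).
Proof: occurrence ⇒ a non-vanishing pairing with a translate of a triple of highest-weight
vectors (`exists_pairing_ne_zero_of_isotypicSum₁₂₃_kroneckerPow_ne_zero`), but all such
pairings vanish (`pairing_matMulRelabel_hook_eq_zero`). The bound of Thm. 4.5 itself is not
affected (tree `burgisserIkenmeyer2013_thm_4_5_holds`, via Strassen–Lickteig).
[cite: BurgisserIkenmeyer2013, Lemma 4.4 and Rem. 4.7 (refuted as printed)] -/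
theorem isotypicSum_bi2013Hook_kroneckerPow_matMulTensor_eq_zero (m κ : ℕ) (hm : 3 ≤ m)
    (hκ : 2 * κ + 1 = m ^ 2) :
    isotypicSum₁ (bi2013Hook κ) (isotypicSum₂ (bi2013Hook κ) (isotypicSum₃ (bi2013Hook κ)
      (kroneckerPow (matMulTensor ℂ m m m) (3 * κ + 1)))) = 0 := by
  classical
  by_contra hne0
  set N := Fintype.card (Fin m × Fin m) with hNdef
  have hNeq : N = 2 * κ + 1 := by
    rw [hNdef, Fintype.card_prod, Fintype.card_fin, hκ, sq]
  set e : Fin m × Fin m ≃ Fin N := Fintype.equivFin (Fin m × Fin m)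
  have hne : isotypicSum₁ (bi2013Hook κ) (isotypicSum₂ (bi2013Hook κ) (isotypicSum₃ (bi2013Hook κ)
      (kroneckerPow (matMulTensor ℂ m m m) (3 * κ + 1)))) ≠ 0 := hne0
  rw [← isotypicSum₁₂₃_kroneckerPow_ne_zero_relabel_iff (matMulTensor ℂ m m m) e e e
    (fun _ : Fin 3 => bi2013Hook κ)] at hne
  obtain ⟨A, B, C, ξ₁, ξ₂, ξ₃, h₁, h₂, h₃, hP⟩ :=
    exists_pairing_ne_zero_of_isotypicSum₁₂₃_kroneckerPow_ne_zero
      (lam := fun _ : Fin 3 => bi2013Hook κ) hne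
  have hN : ∀ x ∈ (bi2013Hook κ).youngDiagram.cells, x.1 < N := fun x hx => by
    rw [hNeq]
    exact fst_lt_of_mem_youngDiagram_bi2013Hook' ((YoungDiagram.mem_cells _).1 hx)
  have hd : (bi2013Hook κ).youngDiagram.cells.card = 3 * κ + 1 :=
    Nat.Partition.card_cells_youngDiagram _
  simp only [← ydWeight_youngDiagram] at h₁ h₂ h₃
  obtain ⟨a₁, rfl⟩ := exists_sum_smul_polytabloid_eq hN hd h₁
  obtain ⟨a₂, rfl⟩ := exists_sum_smul_polytabloid_eq hN hd h₂
  obtain ⟨a₃, rfl⟩ := exists_sum_smul_polytabloid_eq hN hd h₃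
  have hκ1 : 1 ≤ κ := by nlinarith
  exact hP (pairing_matMulRelabel_hook_eq_zero e hN hNeq hm hκ1 A B C a₁ a₂ a₃)

/-- **The named fact `burgisserIkenmeyer2013_rem_4_7` is false** (its `m = 3`, `κ = 4` instance
already): the vanishing half holds (tree `isotypicSum_bi2013Hook_kroneckerPow_unitTensor_eq_zero`)
but the matrix-multiplication half — BI 2013 Lemma 4.4 — fails for every odd `m ≥ 3`
(`isotypicSum_bi2013Hook_kroneckerPow_matMulTensor_eq_zero`). The printed occurrence obstruction
`λ(κ)` against `MaMu_m ∈ closure(GL³_{3κ} E_{3κ})` does not exist: `λ(κ)` occurs in neither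
coordinate ring. [cite: BurgisserIkenmeyer2013, Rem. 4.7 (refuted as printed)] -/
theorem not_burgisserIkenmeyer2013_rem_4_7 : ¬ burgisserIkenmeyer2013_rem_4_7 := fun h =>
  lemma_4_4_of_burgisserIkenmeyer2013_rem_4_7 h 3 4 (by decide) le_rfl (by norm_num)
    (isotypicSum_bi2013Hook_kroneckerPow_matMulTensor_eq_zero 3 4 le_rfl (by norm_num))

end Assembly

end Literature.Computability.AlgebraicComplexity
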